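import Literature.Probability.RandomPlanarGeometry.HexSAWPolygonSupermult
import Literature.Probability.RandomPlanarGeometry.HexSAWEndpointCarriers
import HarnessLib

/-!
# Honeycomb polygon numbers grow in steps of six: `q_N(ℍ) ≤ q_{N+6}(ℍ)` (`N ≥ 6`)

Madras–Slade prove `q_N ≤ q_{N+2}` on `ℤ^d` [MadrasSlade1993, Theorem 3.2.3 (3.2.3), p. 64] by a local surgery at the
lexicographically largest point of a polygon.  On the honeycomb lattice `ℍ` (brick-wall embedding `brickWallGraph`, rooted polygons
`canonEnd n` and `hexPolygonNumber (n+1) = #canonEnd n` from `HexSAWPolygonSupermult` / `HexSAWPolygonNumber`) the faces are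
hexagons, `q_4(ℍ) = q_8(ℍ) = 0`, and no join of two polygons shifts the length by `6`; the steps `4j`, `8`, `10` and every even
`k ≥ 12` are in `HexSAWPolygonMonotone` / `HexSAWPolygonEdgeJoin` (joins with a hexagon, a `10`-gon, a `12`-gon).  This file proves
the remaining step `6` by an explicit injection `canonEnd n → canonEnd (n+6)` (`n ≥ 5`), and concludes — from it and the tree's step `4`
alone (`hexPolygonNumber_le_add_four`; every even `k ≥ 4` is `4a` or `6 + 4a`) — that `q_N(ℍ) ≤ q_{N+k}(ℍ)` for every even `k ≥ 4` and
every `N ≥ 6` (`hexPolygonNumber_le_add_even_of_six_le`, `hexPolygonNumber_mono_of_even_sub`); the step `2` fails at `N = 6, 10` and is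
open for `N ≥ 12`.

## The surgery (five cases at the top-right corner)

For `ω ∈ canonEnd n` let `H` be the maximal height, `xm` the largest abscissa on the row `H`, `(xm, H) = ω i₀` the TOP CORNER
(`exists_top_corner`): its walk-neighbours are `(xm−1, H)` and `(xm, H−1)`, and `(xm−2, H)` precedes `(xm−1, H)`
(`top_corner_pred` / `top_corner_succ`), i.e. the top-right brick `[xm−2, xm] × [H−1, H]` shows on `ω` as the path
`(xm−2,H) – (xm−1,H) – (xm,H) – (xm,H−1)` run forwards (`fwd = true`) or backwards.  A window of `L ∈ {2, 4}` bonds of this path is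
replaced by a path of `L + 6` bonds going over new bricks above the top row (`splice6`, admissibility `Splice6OK`, membership
`splice6_mem_canonEnd`); the replacement paths are the offset tables `offA … offC0` read in the direction `fwd` (`tpath`, `rd`):
* case A (`(xm−3, H) ∈ ω`, then `xm ≥ 3`): window `(xm−3,H)…(xm−1,H)`, new bricks above it — top corner of the image `(xm, H+2)`;
* case B (`(xm−3, H) ∉ ω`, `xm ≥ 3`): window `(xm−2,H)…(xm,H)` pushed up by one brick and right by one column — image corner `(xm+1, H+1)`;
* `xm = 2` (the top row is the single brick in column `0`; then the step below the corner goes to `(1,H−1)` or `(3,H−1)`,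
  `caseC_fwd_step` / `caseC_bwd_step`):
  case C1 (`(3,H−1) ∈ ω`, `(4,H−1) ∉ ω`): window `(2,H)(2,H−1)(3,H−1)` rerouted over the brick to the right — image corner `(5, H+1)`;
  case C2 (`(4,H−1) ∈ ω`, `caseC2_fwd` / `caseC2_bwd`): 4-window `(1,H)…(4,H−1)`… rerouted over a new brick above-left — image corner `(2, H+2)`;
  case C0 (`(1,H−1)` follows: the polygon IS the hexagon, `n = 5`, `caseC0_fwd`; impossible backwards, `caseC0_bwd_false`) — image corner `(3, 2)`.
Admissibility of each table against the extremal properties of `(xm, H)` is `spliceOK_A … spliceOK_C0` (via `splice6OK_of_tables`);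
existence of surgery data for every `ω ∈ canonEnd n`, `n ≥ 5`, is `stepSix_exists` / `sixSpec_nonempty` (data = `SixSpec`, cases = `SixKind`).

## Injectivity (decoding the image intrinsically)

The image `W` has top corner `(xm + dX κ, H + dH κ)` at a known table index (`SixKind.tab`, `topAt_splice`, uniqueness `topAt_unique`),
the orientation `fwd` is read off the predecessor of that corner (`splice_pred_top`), and the case `κ` is read off four site tests
relative to the image corner `(x', H')`: `P1 = (x'−3, H') ∈ W` iff B; `P2 = (x'−4, H'−1) ∈ W` iff C1; `P3 = (x'+1, H'−1) ∈ W` iff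
C2 or C0; `P4 = (x'+2, H'−2)` separates C2 from C0 (`SixSpec.has`, `SixSpec.not_high`, `SixSpec.not_neg`, the bond bookkeeping
`SixPB`, `pb_*`).  Equal images therefore have equal `(κ, H, xm, j, fwd)`, and then `ω₁ = ω₂` by reading `W` outside the window and the
window table inside (`eq_of_splice6_eq`) — `SixSpec.inj`.  Counting: `stepSix`, `card_canonEnd_le_add_six`, `hexPolygonNumber_le_add_six`,
and the corollaries `hexPolygonNumber_le_add_even_of_six_le` (every even step `k ≥ 4`), `hexPolygonNumber_mono_of_even_sub`.

## Door note (a-p4 g16, lane pub-sawmu)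

Tree lemmas used: `mem_canonEnd`, `mem_endAt_iff`, `card_canonEnd`, `apply_one_of_mem_canonEnd`, `adj_cases`, `vertical_cases`,
`pt`, `LexNonneg` (all `HexSAWPolygonSupermult` / `HexSAWPolygonConcatenation` / `HexSAWEndpointCarriers`).  Presearch (corpus fts +
vec, galaxy): no printed proof of a step-`6` monotonicity for honeycomb polygons was found (queries "honeycomb polygon monotone",
"q_{n+2} ≥ q_n hexagonal", "concatenation polygons honeycomb"); the enumerations of [Jensen2006HoneycombPolygons, §2] are consistent
with it.  Every statement below is proved here; the `[cite:]` tags name the `ℤ^d` argument being adapted, not a printed honeycomb statement.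
-/

noncomputable section

open Finset Function Literature.Probability.LatticeModels Literature.Probability.Percolation SimpleGraph

namespace Literature.Probability.RandomPlanarGeometry.SAW

namespace HexBW

namespace PolygonConcat

variable {n : ℕ} {ω : ℕ → Site 2}

/-- Two sites of `ℤ²` are equal iff both coordinates agree. [folklore; lane plumbing] [cite: MadrasSlade1993, §1.1] -/
private theorem s6_site_eq_iff {x y : Site 2} : x = y ↔ x 0 = y 0 ∧ x 1 = y 1 := by
  constructor
  · rintro rfl; exact ⟨rfl, rfl⟩
  · rintro ⟨h0, h1⟩; funext i; fin_cases i <;> assumption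

/-- **The top corner of a canonical polygon.**  For `ω ∈ canonEnd n`, `n ≥ 2`: there are `H ≥ 1` (the maximal height), `xm ≥ 1` (the
largest abscissa on the top row of vertices) and a time `1 ≤ i₀ ≤ n − 1` with `ω i₀ = (xm, H)`, such that the walk-neighbours of
`(xm, H)` are `(xm−1, H)` and `(xm, H−1)` — in one of the two orders. [cite: MadrasSlade1993, §3.2 (proof of Theorem 3.2.3: the lexicographically largest point)] -/
theorem exists_top_corner (hω : ω ∈ canonEnd n) (hn : 2 ≤ n) :
    ∃ (H xm : ℤ) (i₀ : ℕ), 1 ≤ i₀ ∧ i₀ + 1 ≤ n ∧ ω i₀ = pt xm H ∧ 1 ≤ H ∧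
      (∀ i, i ≤ n → ω i 1 ≤ H) ∧ (∀ i, i ≤ n → ω i 1 = H → ω i 0 ≤ xm) ∧
      ((ω (i₀ - 1) = pt (xm - 1) H ∧ ω (i₀ + 1) = pt xm (H - 1)) ∨
        (ω (i₀ + 1) = pt (xm - 1) H ∧ ω (i₀ - 1) = pt xm (H - 1))) := by
  classical
  obtain ⟨hE, hlex⟩ := mem_canonEnd.1 hω
  obtain ⟨⟨h0, -, hbw, hinj⟩, hn'⟩ := mem_endAt_iff.1 hE
  have h1 := apply_one_of_mem_canonEnd hω hn
  -- the maximal height `H`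
  obtain ⟨i₁, hi₁, hmax₁⟩ := exists_max_image (range (n + 1)) (fun i => ω i 1) ⟨0, by simp⟩
  simp only [mem_range, Nat.lt_succ_iff] at hi₁ hmax₁
  set H : ℤ := ω i₁ 1 with hH
  have hH1 : 1 ≤ H := by have := hmax₁ 1 (by omega); rw [h1.2] at this; exact this
  -- the largest abscissa on the top row
  set S : Finset ℕ := (range (n + 1)).filter fun i => ω i 1 = H with hS
  have hSne : S.Nonempty := ⟨i₁, by rw [hS, Finset.mem_filter, Finset.mem_range]; exact ⟨by omega, hH.symm⟩⟩
  obtain ⟨i₀, hi₀S, hmax₀⟩ := exists_max_image S (fun i => ω i 0) hSne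
  have hi₀ : i₀ ≤ n ∧ ω i₀ 1 = H := by
    rw [hS, Finset.mem_filter, Finset.mem_range] at hi₀S; exact ⟨by omega, hi₀S.2⟩
  set xm : ℤ := ω i₀ 0 with hxm
  have hmaxH : ∀ i, i ≤ n → ω i 1 ≤ H := hmax₁
  have hmaxX : ∀ i, i ≤ n → ω i 1 = H → ω i 0 ≤ xm := fun i hi hiH =>
    hmax₀ i (by rw [hS, Finset.mem_filter, Finset.mem_range]; exact ⟨by omega, hiH⟩)
  -- `i₀ ≠ 0, n` (those have height `0 < H`)
  have hi₀0 : i₀ ≠ 0 := by rintro rfl; rw [h0] at hi₀; simp at hi₀; omega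
  have hi₀n : i₀ ≠ n := by rintro rfl; rw [hn'] at hi₀; simp at hi₀; omega
  -- a walk-neighbour of `ω i₀` is the left or the down neighbour
  have key : ∀ z : Site 2, brickWallGraph.Adj (ω i₀) z → (∃ i, i ≤ n ∧ ω i = z) →
      (z = pt (xm - 1) H) ∨ (z = pt xm (H - 1)) := by
    intro z hadj ⟨i, hi, hiz⟩
    have hzH : z 1 ≤ H := by rw [← hiz]; exact hmaxH i hi
    rcases adj_cases hadj with ⟨h1', h2'⟩ | ⟨h1', h2'⟩ | h1'
    · -- right neighbour: height `H`, abscissa `xm + 1`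
      have := hmaxX i hi (by rw [hiz, h2', hi₀.2]); rw [hiz] at this; omega
    · left; rw [s6_site_eq_iff, pt_apply_zero, pt_apply_one]; exact ⟨by omega, by rw [h2', hi₀.2]⟩
    · rcases vertical_cases hadj h1' with ⟨hy, -⟩ | ⟨hy, -⟩
      · rw [hi₀.2] at hy; omega
      · right; rw [s6_site_eq_iff, pt_apply_zero, pt_apply_one]; exact ⟨by rw [h1'], by rw [hi₀.2] at hy; omega⟩
  have hpred_adj : brickWallGraph.Adj (ω i₀) (ω (i₀ - 1)) := by
    have := hbw (i₀ - 1) (by omega); rw [show i₀ - 1 + 1 = i₀ by omega] at this; exact this.symm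
  have hsucc_adj : brickWallGraph.Adj (ω i₀) (ω (i₀ + 1)) := hbw i₀ (by omega)
  have hne : ω (i₀ - 1) ≠ ω (i₀ + 1) := by
    intro h
    have := hinj (show i₀ - 1 ∈ {i | i ≤ n} by simp; omega) (show i₀ + 1 ∈ {i | i ≤ n} by simp; omega) h
    omega
  have hp := key _ hpred_adj ⟨i₀ - 1, by omega, rfl⟩
  have hs := key _ hsucc_adj ⟨i₀ + 1, by omega, rfl⟩
  refine ⟨H, xm, i₀, by omega, by omega, ?_, hH1, hmaxH, hmaxX, ?_⟩
  · rw [s6_site_eq_iff, pt_apply_zero, pt_apply_one]; exact ⟨rfl, hi₀.2⟩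
  rcases hp with hp | hp <;> rcases hs with hs | hs
  · exact absurd (hp.trans hs.symm) hne
  · exact Or.inl ⟨hp, hs⟩
  · exact Or.inr ⟨hs, hp⟩
  · exact absurd (hp.trans hs.symm) hne

/-- **Parity at the top corner**: the vertical bond at `(xm, H)` goes down, so `xm + H` is odd; hence `(xm−1, H)` has no downward bond and
its walk-neighbour other than `(xm, H)` is `(xm−2, H)`.  Forward form: if `ω (i₀−1) = (xm−1, H)` then `2 ≤ i₀` and `ω (i₀−2) = (xm−2, H)`.
[cite: EntingJensen2009, §7.4.2, Fig. 7.10 (brickwork form of the honeycomb lattice)] -/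
theorem top_corner_pred (hω : ω ∈ canonEnd n) {H xm : ℤ} {i₀ : ℕ} (hi₀ : 1 ≤ i₀) (hi₀n : i₀ + 1 ≤ n)
    (hv : ω i₀ = pt xm H) (hmaxH : ∀ i, i ≤ n → ω i 1 ≤ H)
    (hp : ω (i₀ - 1) = pt (xm - 1) H) (hs : ω (i₀ + 1) = pt xm (H - 1)) :
    2 ≤ i₀ ∧ ω (i₀ - 2) = pt (xm - 2) H := by
  obtain ⟨hE, hlex⟩ := mem_canonEnd.1 hω
  obtain ⟨⟨h0, -, hbw, hinj⟩, hn'⟩ := mem_endAt_iff.1 hE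
  -- parity from the vertical bond `ω i₀ – ω (i₀+1)`
  have hvert := vertical_cases (hbw i₀ (by omega)) (by rw [hv, hs]; simp)
  have hpar : (xm + (H - 1)) % 2 = 0 := by
    rw [hv, hs] at hvert; simp only [pt_apply_zero, pt_apply_one] at hvert; omega
  -- `i₀ ≠ 1`: else `ω 0 = (xm-1, H)` has height `H ≥ … `; `ω 0 = 0` forces `H = 0`, but `ω 1 = (0,1)` has height `1 ≤ H`
  have hH1 : 1 ≤ H := by
    have h1 := apply_one_of_mem_canonEnd hω (by omega)
    have := hmaxH 1 (by omega); rw [h1.2] at this; exact this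
  have hi₀2 : 2 ≤ i₀ := by
    by_contra hlt
    have hi : i₀ = 1 := by omega
    rw [hi] at hp; simp only [Nat.sub_self] at hp
    rw [h0] at hp
    have := congrFun hp 1; simp at this; omega
  refine ⟨hi₀2, ?_⟩
  -- the walk-neighbour `ω (i₀-2)` of `ω (i₀-1) = (xm-1, H)`
  have hadj : brickWallGraph.Adj (ω (i₀ - 1)) (ω (i₀ - 2)) := by
    have := hbw (i₀ - 2) (by omega); rw [show i₀ - 2 + 1 = i₀ - 1 by omega] at this; exact this.symm
  have hne : ω (i₀ - 2) ≠ ω i₀ := by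
    intro h
    have := hinj (show i₀ - 2 ∈ {i | i ≤ n} by simp; omega) (show i₀ ∈ {i | i ≤ n} by simp; omega) h
    omega
  have hzH : ω (i₀ - 2) 1 ≤ H := hmaxH _ (by omega)
  rw [hp] at hadj
  rcases adj_cases hadj with ⟨h1', h2'⟩ | ⟨h1', h2'⟩ | h1'
  · -- right neighbour of `(xm-1,H)` is `(xm,H) = ω i₀`
    exfalso; apply hne; rw [hv, s6_site_eq_iff]; simp only [pt_apply_zero, pt_apply_one] at h1' h2' ⊢; exact ⟨by omega, by omega⟩
  · rw [s6_site_eq_iff]; simp only [pt_apply_zero, pt_apply_one] at h1' h2' ⊢; exact ⟨by omega, by omega⟩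
  · -- vertical neighbour of `(xm-1, H)`: up is too high, down does not exist (parity)
    exfalso
    rcases vertical_cases hadj h1' with ⟨hy, hpar'⟩ | ⟨hy, hpar'⟩
    · simp only [pt_apply_one] at hy; omega
    · simp only [pt_apply_zero, pt_apply_one] at hy hpar' h1'; omega


/-! ### The generic top surgery: replace `ω[j .. j+L]` by a path of length `L + 6` -/

section Splice

variable {L j : ℕ} {π : ℕ → Site 2}

/-- **Splice**: `ω` up to time `j`, then the path `π(0 .. L+6)` (with `π 0 = ω j`, `π (L+6) = ω (j+L)`), then `ω` from time `j+L` on —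
a walk of length `n + 6`. [cite: MadrasSlade1993, §3.2 (proof of Theorem 3.2.3: local surgery on a polygon)] -/
def splice6 (L : ℕ) (ω π : ℕ → Site 2) (j : ℕ) (i : ℕ) : Site 2 :=
  if i ≤ j then ω i else if i ≤ j + L + 6 then π (i - j) else ω (i - 6)

/-- Before the window. [cite: MadrasSlade1993, §3.2 (proof of Theorem 3.2.3)] -/
theorem splice6_of_le {i : ℕ} (h : i ≤ j) : splice6 L ω π j i = ω i := if_pos h

/-- On the new path (both ends included, given `π 0 = ω j`). [cite: MadrasSlade1993, §3.2 (proof of Theorem 3.2.3)] -/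
theorem splice6_mid (hπ0 : π 0 = ω j) {s : ℕ} (hs : s ≤ L + 6) : splice6 L ω π j (j + s) = π s := by
  unfold splice6
  rcases Nat.eq_zero_or_pos s with rfl | hs0
  · rw [if_pos (by omega), hπ0, add_zero]
  · rw [if_neg (by omega), if_pos (by omega), Nat.add_sub_cancel_left]

/-- After the window (its end included, given `π (L+6) = ω (j+L)`). [cite: MadrasSlade1993, §3.2 (proof of Theorem 3.2.3)] -/
theorem splice6_of_ge (hπL : π (L + 6) = ω (j + L)) {i : ℕ} (h : j + L + 6 ≤ i) : splice6 L ω π j i = ω (i - 6) := by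
  unfold splice6
  rw [if_neg (by omega)]
  rcases eq_or_lt_of_le h with rfl | hlt
  · rw [if_pos le_rfl, show j + L + 6 - j = L + 6 by omega, hπL, show j + L + 6 - 6 = j + L by omega]
  · rw [if_neg (by omega)]

/-- Hypotheses of the top surgery on the new path `π`: a self-avoiding brick-wall path of length `L + 6` between `ω j` and `ω (j+L)`
whose interior avoids every site of `ω` outside the window, all of whose sites are lexicographically `≥ 0`.
[cite: MadrasSlade1993, §3.2 (proof of Theorem 3.2.3)] -/
structure Splice6OK (n L : ℕ) (ω : ℕ → Site 2) (j : ℕ) (π : ℕ → Site 2) : Prop where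
  one_le : 1 ≤ L
  wnd : j + L ≤ n
  start : π 0 = ω j
  finish : π (L + 6) = ω (j + L)
  adj : ∀ s, s < L + 6 → brickWallGraph.Adj (π s) (π (s + 1))
  inj : Set.InjOn π {s | s ≤ L + 6}
  fresh : ∀ s, 0 < s → s < L + 6 → ∀ i, i ≤ n → (i < j ∨ j + L < i) → π s ≠ ω i
  lex : ∀ s, s ≤ L + 6 → LexNonneg (π s)

/-- **The spliced walk is a rooted `(n+7)`-gon**: `splice6 L ω π j ∈ E_{n+6}(e₀)` for `ω ∈ E_n(e₀)` and a path satisfying `Splice6OK`.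
[cite: MadrasSlade1993, §3.2 (proof of Theorem 3.2.3: "the result is a self-avoiding polygon")] -/
theorem splice6_mem (hω : ω ∈ endAt n (Pi.single 0 1 : Site 2)) (hP : Splice6OK n L ω j π) :
    splice6 L ω π j ∈ endAt (n + 6) (Pi.single 0 1 : Site 2) := by
  obtain ⟨⟨h0, hfr, hbw, hinj⟩, hn'⟩ := mem_endAt_iff.1 hω
  have hL := hP.one_le
  have hwnd := hP.wnd
  have hge : ∀ i, j + L + 6 ≤ i → splice6 L ω π j i = ω (i - 6) := fun i hi => splice6_of_ge hP.finish hi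
  rw [mem_endAt_iff]
  refine ⟨⟨by rw [splice6_of_le (Nat.zero_le _), h0], ?_, ?_, ?_⟩, ?_⟩
  · -- frozen after `n + 6`
    intro i hi
    rw [hge i (by omega), hge (n + 6) (by omega), hfr _ (by omega), show n + 6 - 6 = n by omega]
  · -- steps
    intro i hi
    rcases Nat.lt_or_ge i j with h1 | h1
    · rw [splice6_of_le h1.le, splice6_of_le (by omega)]; exact hbw i (by omega)
    rcases Nat.lt_or_ge i (j + L + 6) with h2 | h2
    · obtain ⟨s, rfl⟩ : ∃ s, i = j + s := ⟨i - j, by omega⟩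
      rw [splice6_mid hP.start (by omega), show j + s + 1 = j + (s + 1) by omega, splice6_mid hP.start (by omega)]
      exact hP.adj s (by omega)
    · rw [hge i h2, hge (i + 1) (by omega), show i + 1 - 6 = i - 6 + 1 by omega]
      exact hbw _ (by omega)
  · -- injective on `[0, n+6]`
    have hout : ∀ i, i ≤ n + 6 → (i ≤ j ∨ j + L + 6 ≤ i) →
        ∃ a, a ≤ n ∧ splice6 L ω π j i = ω a ∧ (i ≤ j → a = i) ∧ (j + L + 6 ≤ i → a = i - 6) := by
      intro i hi hio
      rcases hio with h1 | h1
      · exact ⟨i, by omega, splice6_of_le h1, fun _ => rfl, fun h => by omega⟩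
      · exact ⟨i - 6, by omega, hge i h1, fun h => by omega, fun _ => rfl⟩
    -- a site of `ω` equal to an interior site of `π` is impossible
    have hcross : ∀ a s, a ≤ n → (a ≤ j ∨ j + L ≤ a) → 0 < s → s < L + 6 → ω a ≠ π s := by
      intro a s ha hajL hs1 hs2 heq
      rcases hajL with h1 | h1
      · rcases eq_or_lt_of_le h1 with rfl | hlt
        · rw [← hP.start] at heq
          have := hP.inj (show 0 ∈ {s | s ≤ L + 6} by simp) (show s ∈ {s | s ≤ L + 6} by simp; omega) heq; omega
        · exact hP.fresh s hs1 hs2 a ha (Or.inl hlt) heq.symm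
      · rcases eq_or_lt_of_le h1 with h2 | hlt
        · rw [← h2, ← hP.finish] at heq
          have := hP.inj (show L + 6 ∈ {s | s ≤ L + 6} by simp) (show s ∈ {s | s ≤ L + 6} by simp; omega) heq; omega
        · exact hP.fresh s hs1 hs2 a ha (Or.inr hlt) heq.symm
    suffices key : ∀ i i', i < i' → i' ≤ n + 6 → splice6 L ω π j i ≠ splice6 L ω π j i' by
      intro i hi i' hi' h
      simp only [Set.mem_setOf_eq] at hi hi'
      by_contra hne
      rcases Nat.lt_or_gt_of_ne hne with hlt | hlt
      · exact key i i' hlt hi' h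
      · exact key i' i hlt hi h.symm
    intro i i' hlt hi' h
    by_cases hwi : j < i ∧ i < j + L + 6 <;> by_cases hwi' : j < i' ∧ i' < j + L + 6
    · obtain ⟨s, rfl⟩ : ∃ s, i = j + s := ⟨i - j, by omega⟩
      obtain ⟨s', rfl⟩ : ∃ s', i' = j + s' := ⟨i' - j, by omega⟩
      rw [splice6_mid hP.start (by omega), splice6_mid hP.start (by omega)] at h
      have := hP.inj (show s ∈ {s | s ≤ L + 6} by simp; omega) (show s' ∈ {s | s ≤ L + 6} by simp; omega) h
      omega
    · obtain ⟨s, rfl⟩ : ∃ s, i = j + s := ⟨i - j, by omega⟩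
      obtain ⟨a, ha, hia, ha1, ha2⟩ := hout i' hi' (by omega)
      rw [splice6_mid hP.start (by omega), hia] at h
      refine hcross a s ha ?_ (by omega) (by omega) h.symm
      rcases le_or_gt i' j with h1 | h1
      · left; rw [ha1 h1]; exact h1
      · right; rw [ha2 (by omega)]; omega
    · obtain ⟨s', rfl⟩ : ∃ s', i' = j + s' := ⟨i' - j, by omega⟩
      obtain ⟨a, ha, hia, ha1, ha2⟩ := hout i (by omega) (by omega)
      rw [splice6_mid hP.start (by omega), hia] at h
      refine hcross a s' ha ?_ (by omega) (by omega) h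
      rcases le_or_gt i j with h1 | h1
      · left; rw [ha1 h1]; exact h1
      · right; rw [ha2 (by omega)]; omega
    · obtain ⟨a, ha, hia, ha1, ha2⟩ := hout i (by omega) (by omega)
      obtain ⟨a', ha', hia', ha1', ha2'⟩ := hout i' hi' (by omega)
      rw [hia, hia'] at h
      have haa := hinj (show a ∈ {i | i ≤ n} by simpa using ha) (show a' ∈ {i | i ≤ n} by simpa using ha') h
      have : a < a' := by
        rcases le_or_gt i j with h1 | h1 <;> rcases le_or_gt i' j with h2 | h2
        · rw [ha1 h1, ha1' h2]; exact hlt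
        · rw [ha1 h1, ha2' (by omega)]; omega
        · omega
        · rw [ha2 (by omega), ha2' (by omega)]; omega
      omega
  · rw [hge (n + 6) (by omega), show n + 6 - 6 = n by omega, hn']

/-- **The spliced walk is canonical** when `ω` is and the new path is lexicographically `≥ 0`.
[cite: MadrasSlade1993, §3.2 (proof of Theorem 3.2.3: `Q[N]`)] -/
theorem splice6_mem_canonEnd (hω : ω ∈ canonEnd n) (hP : Splice6OK n L ω j π) : splice6 L ω π j ∈ canonEnd (n + 6) := by
  obtain ⟨hE, hlex⟩ := mem_canonEnd.1 hω
  refine mem_canonEnd.2 ⟨splice6_mem hE hP, fun i hi => ?_⟩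
  rcases le_or_gt i j with h1 | h1
  · rw [splice6_of_le h1]; exact hlex i (by have := hP.wnd; omega)
  rcases Nat.lt_or_ge i (j + L + 6) with h2 | h2
  · obtain ⟨s, rfl⟩ : ∃ s, i = j + s := ⟨i - j, by omega⟩
    rw [splice6_mid hP.start (by omega)]; exact hP.lex s (by omega)
  · rw [splice6_of_ge hP.finish h2]; exact hlex _ (by omega)

end Splice

/-! ### The five replacement paths (offset tables relative to the top corner `(xm, H)`) -/

section Tables

/-- Reading a table forwards or backwards. [cite: MadrasSlade1993, §3.2 (proof of Theorem 3.2.3)] -/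
def rd (fwd : Bool) (K s : ℕ) : ℕ := if fwd then s else K - s

/-- `rd` stays in range. [cite: MadrasSlade1993, §3.2] -/
theorem rd_le {fwd : Bool} {K s : ℕ} (hs : s ≤ K) : rd fwd K s ≤ K := by
  unfold rd; split_ifs <;> omega

/-- `rd` is injective on `[0, K]`. [cite: MadrasSlade1993, §3.2] -/
theorem rd_inj {fwd : Bool} {K s s' : ℕ} (hs : s ≤ K) (hs' : s' ≤ K) (h : rd fwd K s = rd fwd K s') : s = s' := by
  unfold rd at h; split_ifs at h <;> omega

/-- Consecutive indices read consecutive (or reversed consecutive) entries. [cite: MadrasSlade1993, §3.2] -/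
theorem rd_succ {fwd : Bool} {K s : ℕ} (hs : s < K) :
    (fwd = true ∧ rd fwd K (s + 1) = rd fwd K s + 1) ∨ (fwd = false ∧ rd fwd K s = rd fwd K (s + 1) + 1) := by
  unfold rd; cases fwd
  · right; simp; omega
  · left; simp

/-- Case A path (over `ℓ ∪ cR`, bricks `c' = [xm−3,xm−1]×[H,H+1]`, `t = [xm−2,xm]×[H+1,H+2]`): from `(xm−3,H)` to `(xm−1,H)`, 8 bonds.
[cite: MadrasSlade1993, §3.2 (proof of Theorem 3.2.3: local surgery)] -/
def offA : ℕ → ℤ × ℤ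
  | 0 => (-3, 0) | 1 => (-3, 1) | 2 => (-2, 1) | 3 => (-2, 2) | 4 => (-1, 2) | 5 => (0, 2) | 6 => (0, 1) | 7 => (-1, 1) | _ => (-1, 0)

/-- Case B path (bricks `c'' = [xm−3,xm−1]×[H,H+1]`, `c' = [xm−1,xm+1]×[H,H+1]`): from `(xm−2,H)` to `(xm,H)`, 8 bonds.
[cite: MadrasSlade1993, §3.2 (proof of Theorem 3.2.3: local surgery)] -/
def offB : ℕ → ℤ × ℤ
  | 0 => (-2, 0) | 1 => (-3, 0) | 2 => (-3, 1) | 3 => (-2, 1) | 4 => (-1, 1) | 5 => (0, 1) | 6 => (1, 1) | 7 => (1, 0) | _ => (0, 0)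

/-- Case C1 path (`xm = 2`; bricks `r = [2,4]×[H−1,H]`, `t' = [3,5]×[H,H+1]`): from `(2,H)` to `(3,H−1)`, 8 bonds (offsets from `(2,H)`).
[cite: MadrasSlade1993, §3.2 (proof of Theorem 3.2.3: local surgery)] -/
def offC1 : ℕ → ℤ × ℤ
  | 0 => (0, 0) | 1 => (1, 0) | 2 => (1, 1) | 3 => (2, 1) | 4 => (3, 1) | 5 => (3, 0) | 6 => (2, 0) | 7 => (2, -1) | _ => (1, -1)

/-- Case C2 path (`xm = 2`; bricks `r`, `c' = [1,3]×[H,H+1]`, `t = [0,2]×[H+1,H+2]`): from `(1,H)` to `(4,H−1)`, 10 bonds (offsets from `(2,H)`).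
[cite: MadrasSlade1993, §3.2 (proof of Theorem 3.2.3: local surgery)] -/
def offC2 : ℕ → ℤ × ℤ
  | 0 => (-1, 0) | 1 => (-1, 1) | 2 => (-2, 1) | 3 => (-2, 2) | 4 => (-1, 2) | 5 => (0, 2) | 6 => (0, 1) | 7 => (1, 1)
  | 8 => (1, 0) | 9 => (2, 0) | _ => (2, -1)

/-- Case C0 path (the hexagon ↦ the three-brick triangle): from `(xm−1,H)` to `(xm,H−1)`, 8 bonds.
[cite: MadrasSlade1993, §3.2 (proof of Theorem 3.2.3: local surgery)] -/
def offC0 : ℕ → ℤ × ℤ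
  | 0 => (-1, 0) | 1 => (-1, 1) | 2 => (0, 1) | 3 => (1, 1) | 4 => (1, 0) | 5 => (2, 0) | 6 => (2, -1) | 7 => (1, -1) | _ => (0, -1)

/-- The path of a table, read in direction `fwd`, based at `(xm, H)`. [cite: MadrasSlade1993, §3.2 (proof of Theorem 3.2.3)] -/
def tpath (off : ℕ → ℤ × ℤ) (K : ℕ) (xm H : ℤ) (fwd : Bool) (s : ℕ) : Site 2 :=
  pt (xm + (off (rd fwd K s)).1) (H + (off (rd fwd K s)).2)

variable {xm H : ℤ} {fwd : Bool}

/-- Table A is a brick-wall path (given the top-corner parity `xm + H` odd). [cite: EntingJensen2009, §7.4.2, Fig. 7.10] -/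
theorem offA_adj (hpar : (xm + H) % 2 = 1) {s : ℕ} (hs : s < 8) :
    brickWallGraph.Adj (pt (xm + (offA s).1) (H + (offA s).2)) (pt (xm + (offA (s + 1)).1) (H + (offA (s + 1)).2)) := by
  interval_cases s <;> simp only [offA] <;> exact adj_pt_iff.2 (by omega)

/-- Table B is a brick-wall path. [cite: EntingJensen2009, §7.4.2, Fig. 7.10] -/
theorem offB_adj (hpar : (xm + H) % 2 = 1) {s : ℕ} (hs : s < 8) :
    brickWallGraph.Adj (pt (xm + (offB s).1) (H + (offB s).2)) (pt (xm + (offB (s + 1)).1) (H + (offB (s + 1)).2)) := by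
  interval_cases s <;> simp only [offB] <;> exact adj_pt_iff.2 (by omega)

/-- Table C1 is a brick-wall path (`xm = 2`, `H` odd). [cite: EntingJensen2009, §7.4.2, Fig. 7.10] -/
theorem offC1_adj (hxm : xm = 2) (hpar : (xm + H) % 2 = 1) {s : ℕ} (hs : s < 8) :
    brickWallGraph.Adj (pt (xm + (offC1 s).1) (H + (offC1 s).2)) (pt (xm + (offC1 (s + 1)).1) (H + (offC1 (s + 1)).2)) := by
  interval_cases s <;> simp only [offC1] <;> exact adj_pt_iff.2 (by omega)

/-- Table C2 is a brick-wall path (`xm = 2`, `H` odd). [cite: EntingJensen2009, §7.4.2, Fig. 7.10] -/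
theorem offC2_adj (hxm : xm = 2) (hpar : (xm + H) % 2 = 1) {s : ℕ} (hs : s < 10) :
    brickWallGraph.Adj (pt (xm + (offC2 s).1) (H + (offC2 s).2)) (pt (xm + (offC2 (s + 1)).1) (H + (offC2 (s + 1)).2)) := by
  interval_cases s <;> simp only [offC2] <;> exact adj_pt_iff.2 (by omega)

/-- Table C0 is a brick-wall path. [cite: EntingJensen2009, §7.4.2, Fig. 7.10] -/
theorem offC0_adj (hpar : (xm + H) % 2 = 1) {s : ℕ} (hs : s < 8) :
    brickWallGraph.Adj (pt (xm + (offC0 s).1) (H + (offC0 s).2)) (pt (xm + (offC0 (s + 1)).1) (H + (offC0 (s + 1)).2)) := by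
  interval_cases s <;> simp only [offC0] <;> exact adj_pt_iff.2 (by omega)

/-- Table A is injective on `[0,8]`. [cite: MadrasSlade1993, §3.2] -/
theorem offA_inj {s s' : ℕ} (hs : s ≤ 8) (hs' : s' ≤ 8)
    (h : pt (xm + (offA s).1) (H + (offA s).2) = pt (xm + (offA s').1) (H + (offA s').2)) : s = s' := by
  interval_cases s <;> interval_cases s' <;> simp only [offA] at h <;>
    first | rfl | (obtain ⟨h1, h2⟩ := pt_inj.1 h; omega)

/-- Table B is injective on `[0,8]`. [cite: MadrasSlade1993, §3.2] -/
theorem offB_inj {s s' : ℕ} (hs : s ≤ 8) (hs' : s' ≤ 8)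
    (h : pt (xm + (offB s).1) (H + (offB s).2) = pt (xm + (offB s').1) (H + (offB s').2)) : s = s' := by
  interval_cases s <;> interval_cases s' <;> simp only [offB] at h <;>
    first | rfl | (obtain ⟨h1, h2⟩ := pt_inj.1 h; omega)

/-- Table C1 is injective on `[0,8]`. [cite: MadrasSlade1993, §3.2] -/
theorem offC1_inj {s s' : ℕ} (hs : s ≤ 8) (hs' : s' ≤ 8)
    (h : pt (xm + (offC1 s).1) (H + (offC1 s).2) = pt (xm + (offC1 s').1) (H + (offC1 s').2)) : s = s' := by
  interval_cases s <;> interval_cases s' <;> simp only [offC1] at h <;>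
    first | rfl | (obtain ⟨h1, h2⟩ := pt_inj.1 h; omega)

/-- Table C2 is injective on `[0,10]`. [cite: MadrasSlade1993, §3.2] -/
theorem offC2_inj {s s' : ℕ} (hs : s ≤ 10) (hs' : s' ≤ 10)
    (h : pt (xm + (offC2 s).1) (H + (offC2 s).2) = pt (xm + (offC2 s').1) (H + (offC2 s').2)) : s = s' := by
  interval_cases s <;> interval_cases s' <;> simp only [offC2] at h <;>
    first | rfl | (obtain ⟨h1, h2⟩ := pt_inj.1 h; omega)

/-- Table C0 is injective on `[0,8]`. [cite: MadrasSlade1993, §3.2] -/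
theorem offC0_inj {s s' : ℕ} (hs : s ≤ 8) (hs' : s' ≤ 8)
    (h : pt (xm + (offC0 s).1) (H + (offC0 s).2) = pt (xm + (offC0 s').1) (H + (offC0 s').2)) : s = s' := by
  interval_cases s <;> interval_cases s' <;> simp only [offC0] at h <;>
    first | rfl | (obtain ⟨h1, h2⟩ := pt_inj.1 h; omega)

/-- A table path is a brick-wall path in either direction. [cite: MadrasSlade1993, §3.2 (proof of Theorem 3.2.3)] -/
theorem tpath_adj {off : ℕ → ℤ × ℤ} {K : ℕ}
    (hadj : ∀ s, s < K → brickWallGraph.Adj (pt (xm + (off s).1) (H + (off s).2)) (pt (xm + (off (s + 1)).1) (H + (off (s + 1)).2)))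
    {s : ℕ} (hs : s < K) : brickWallGraph.Adj (tpath off K xm H fwd s) (tpath off K xm H fwd (s + 1)) := by
  unfold tpath rd
  cases fwd
  · simp only [Bool.false_eq_true, ↓reduceIte]
    rw [show K - s = K - (s + 1) + 1 by omega]
    exact (hadj _ (by omega)).symm
  · simp only [↓reduceIte]
    exact hadj _ hs

/-- A table path is injective in either direction. [cite: MadrasSlade1993, §3.2 (proof of Theorem 3.2.3)] -/
theorem tpath_injOn {off : ℕ → ℤ × ℤ} {K : ℕ}
    (hinj : ∀ s s', s ≤ K → s' ≤ K → pt (xm + (off s).1) (H + (off s).2) = pt (xm + (off s').1) (H + (off s').2) → s = s') :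
    Set.InjOn (tpath off K xm H fwd) {s | s ≤ K} := by
  intro s hs s' hs' h
  simp only [Set.mem_setOf_eq] at hs hs'
  exact rd_inj hs hs' (hinj _ _ (rd_le hs) (rd_le hs') h)

/-- The sites of a table path are the table's sites. [cite: MadrasSlade1993, §3.2] -/
theorem tpath_mem {off : ℕ → ℤ × ℤ} {K : ℕ} {s : ℕ} (hs : s ≤ K) :
    ∃ u, u ≤ K ∧ tpath off K xm H fwd s = pt (xm + (off u).1) (H + (off u).2) := ⟨rd fwd K s, rd_le hs, rfl⟩

/-- Endpoints of a table path, forwards. [cite: MadrasSlade1993, §3.2] -/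
theorem tpath_zero_true {off : ℕ → ℤ × ℤ} {K : ℕ} : tpath off K xm H true 0 = pt (xm + (off 0).1) (H + (off 0).2) := by
  simp [tpath, rd]

/-- Endpoints of a table path, forwards. [cite: MadrasSlade1993, §3.2] -/
theorem tpath_last_true {off : ℕ → ℤ × ℤ} {K : ℕ} : tpath off K xm H true K = pt (xm + (off K).1) (H + (off K).2) := by
  simp [tpath, rd]

/-- Endpoints of a table path, backwards. [cite: MadrasSlade1993, §3.2] -/
theorem tpath_zero_false {off : ℕ → ℤ × ℤ} {K : ℕ} : tpath off K xm H false 0 = pt (xm + (off K).1) (H + (off K).2) := by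
  simp [tpath, rd]

/-- Endpoints of a table path, backwards. [cite: MadrasSlade1993, §3.2] -/
theorem tpath_last_false {off : ℕ → ℤ × ℤ} {K : ℕ} : tpath off K xm H false K = pt (xm + (off 0).1) (H + (off 0).2) := by
  simp [tpath, rd]

end Tables

/-! ### From tables to the surgery hypotheses -/

section FromTables

variable {xm H : ℤ} {fwd : Bool} {j L : ℕ}

/-- Interior indices are read as interior indices. [cite: MadrasSlade1993, §3.2] -/
theorem rd_pos_lt {K s : ℕ} (h0 : 0 < s) (h1 : s < K) : 0 < rd fwd K s ∧ rd fwd K s < K := by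
  unfold rd; split_ifs <;> omega

/-- **Surgery hypotheses from tables**: a window table `w` (length `L`) matched by `ω` at times `j … j+L` and a replacement table `off`
(length `L + 6`) with the same endpoints, which is a self-avoiding brick-wall path whose interior sites avoid `ω` outside the window and
whose sites are lexicographically `≥ 0`, give `Splice6OK`. [cite: MadrasSlade1993, §3.2 (proof of Theorem 3.2.3: local surgery)] -/
theorem splice6OK_of_tables {off w : ℕ → ℤ × ℤ} (hL : 1 ≤ L) (h0 : off 0 = w 0) (hKL : off (L + 6) = w L)
    (hadj : ∀ s, s < L + 6 → brickWallGraph.Adj (pt (xm + (off s).1) (H + (off s).2)) (pt (xm + (off (s + 1)).1) (H + (off (s + 1)).2)))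
    (hinj : ∀ s s', s ≤ L + 6 → s' ≤ L + 6 →
      pt (xm + (off s).1) (H + (off s).2) = pt (xm + (off s').1) (H + (off s').2) → s = s')
    (hfresh : ∀ u, 0 < u → u < L + 6 → ∀ i, i ≤ n → (i < j ∨ j + L < i) → pt (xm + (off u).1) (H + (off u).2) ≠ ω i)
    (hlex : ∀ u, u ≤ L + 6 → LexNonneg (pt (xm + (off u).1) (H + (off u).2)))
    (hw : ∀ s, s ≤ L → ω (j + s) = tpath w L xm H fwd s) (hwnd : j + L ≤ n) :
    Splice6OK n L ω j (tpath off (L + 6) xm H fwd) := by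
  refine ⟨hL, hwnd, ?_, ?_, fun s hs => tpath_adj hadj hs, tpath_injOn hinj, ?_, ?_⟩
  · -- start
    have h := hw 0 (Nat.zero_le _); rw [add_zero] at h; rw [h]
    cases fwd
    · rw [tpath_zero_false, tpath_zero_false, hKL]
    · rw [tpath_zero_true, tpath_zero_true, h0]
  · -- finish
    rw [hw L le_rfl]
    cases fwd
    · rw [tpath_last_false, tpath_last_false, h0]
    · rw [tpath_last_true, tpath_last_true, hKL]
  · -- fresh
    intro s hs0 hs1 i hi hio
    obtain ⟨hu0, hu1⟩ := rd_pos_lt (fwd := fwd) hs0 hs1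
    exact hfresh _ hu0 hu1 i hi hio
  · -- lex
    intro s hs
    exact hlex _ (rd_le hs)

end FromTables

/-! ### The five surgeries satisfy the hypotheses -/

section Cases

variable {xm H : ℤ} {fwd : Bool} {j : ℕ}

/-- `pt a b` is lexicographically `≥ 0` when `a > 0`, or `a = 0 ≤ b`. [cite: MadrasSlade1993, §3.2 (proof of Theorem 3.2.3: `Q[N]`)] -/
private theorem s6_lexNonneg_pt {a b : ℤ} (h : 0 < a ∨ (a = 0 ∧ 0 ≤ b)) : LexNonneg (pt a b) := by
  unfold LexNonneg; simpa using h

/-- A site above the top row, or on the top row right of the top corner, is not on `ω`. [cite: MadrasSlade1993, §3.2 (proof of Theorem 3.2.3)] -/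
theorem ne_of_high {a b : ℤ} (hmaxH : ∀ i, i ≤ n → ω i 1 ≤ H) (hmaxX : ∀ i, i ≤ n → ω i 1 = H → ω i 0 ≤ xm)
    (h : H < b ∨ (b = H ∧ xm < a)) {i : ℕ} (hi : i ≤ n) : pt a b ≠ ω i := by
  intro he
  have h1 := hmaxH i hi; have h2 := hmaxX i hi
  rw [← he] at h1 h2; simp only [pt_apply_zero, pt_apply_one] at h1 h2
  rcases h with h | ⟨hb, ha⟩
  · omega
  · have := h2 hb; omega

/-- Window table of case A: `(xm−3,H), (xm−2,H), (xm−1,H)`. [cite: MadrasSlade1993, §3.2] -/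
def w6A : ℕ → ℤ × ℤ | 0 => (-3, 0) | 1 => (-2, 0) | _ => (-1, 0)
/-- Window table of case B: `(xm−2,H), (xm−1,H), (xm,H)`. [cite: MadrasSlade1993, §3.2] -/
def w6B : ℕ → ℤ × ℤ | 0 => (-2, 0) | 1 => (-1, 0) | _ => (0, 0)
/-- Window table of case C1 (offsets from `(2,H)`): `(2,H), (2,H−1), (3,H−1)`. [cite: MadrasSlade1993, §3.2] -/
def w6C1 : ℕ → ℤ × ℤ | 0 => (0, 0) | 1 => (0, -1) | _ => (1, -1)
/-- Window table of case C2 (offsets from `(2,H)`): `(1,H), (2,H), (2,H−1), (3,H−1), (4,H−1)`. [cite: MadrasSlade1993, §3.2] -/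
def w6C2 : ℕ → ℤ × ℤ | 0 => (-1, 0) | 1 => (0, 0) | 2 => (0, -1) | 3 => (1, -1) | _ => (2, -1)
/-- Window table of case C0: `(xm−1,H), (xm,H), (xm,H−1)`. [cite: MadrasSlade1993, §3.2] -/
def w6C0 : ℕ → ℤ × ℤ | 0 => (-1, 0) | 1 => (0, 0) | _ => (0, -1)

/-- **Case A surgery is admissible** (`xm ≥ 3`; no case hypothesis beyond the window: all new interior sites lie above the top row).
[cite: MadrasSlade1993, §3.2 (proof of Theorem 3.2.3: local surgery)] -/
theorem spliceOK_A (hpar : (xm + H) % 2 = 1) (hx : 3 ≤ xm) (hH : 0 ≤ H)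
    (hmaxH : ∀ i, i ≤ n → ω i 1 ≤ H) (hmaxX : ∀ i, i ≤ n → ω i 1 = H → ω i 0 ≤ xm)
    (hw : ∀ s, s ≤ 2 → ω (j + s) = tpath w6A 2 xm H fwd s) (hwnd : j + 2 ≤ n) :
    Splice6OK n 2 ω j (tpath offA 8 xm H fwd) := by
  refine splice6OK_of_tables (L := 2) (w := w6A) (by norm_num) (by rfl) (by rfl) (fun s hs => offA_adj hpar hs)
    (fun s s' hs hs' h => offA_inj hs hs' h) (fun u hu0 hu1 i hi _ => ?_) (fun u hu => ?_) hw hwnd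
  · interval_cases u <;> simp only [offA] <;> exact ne_of_high hmaxH hmaxX (by omega) hi
  · interval_cases u <;> simp only [offA] <;> exact s6_lexNonneg_pt (by omega)

/-- **Case B surgery is admissible** (`xm ≥ 3`, and `(xm−3, H)` is NOT a site of `ω`).
[cite: MadrasSlade1993, §3.2 (proof of Theorem 3.2.3: local surgery)] -/
theorem spliceOK_B (hpar : (xm + H) % 2 = 1) (hx : 3 ≤ xm) (hH : 0 ≤ H)
    (hmaxH : ∀ i, i ≤ n → ω i 1 ≤ H) (hmaxX : ∀ i, i ≤ n → ω i 1 = H → ω i 0 ≤ xm)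
    (hB : ∀ i, i ≤ n → ω i ≠ pt (xm - 3) H)
    (hw : ∀ s, s ≤ 2 → ω (j + s) = tpath w6B 2 xm H fwd s) (hwnd : j + 2 ≤ n) :
    Splice6OK n 2 ω j (tpath offB 8 xm H fwd) := by
  refine splice6OK_of_tables (L := 2) (w := w6B) (by norm_num) (by rfl) (by rfl) (fun s hs => offB_adj hpar hs)
    (fun s s' hs hs' h => offB_inj hs hs' h) (fun u hu0 hu1 i hi _ => ?_) (fun u hu => ?_) hw hwnd
  · interval_cases u <;> simp only [offB] <;>
      first | exact ne_of_high hmaxH hmaxX (by omega) hi | (rw [show xm + -3 = xm - 3 by ring, add_zero]; exact fun h => hB i hi h.symm)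
  · interval_cases u <;> simp only [offB] <;> exact s6_lexNonneg_pt (by omega)

/-- **Case C1 surgery is admissible** (`xm = 2`, and `(4, H−1)` is NOT a site of `ω`).
[cite: MadrasSlade1993, §3.2 (proof of Theorem 3.2.3: local surgery)] -/
theorem spliceOK_C1 (hpar : (xm + H) % 2 = 1) (hx : xm = 2)
    (hmaxH : ∀ i, i ≤ n → ω i 1 ≤ H) (hmaxX : ∀ i, i ≤ n → ω i 1 = H → ω i 0 ≤ xm)
    (hC : ∀ i, i ≤ n → ω i ≠ pt 4 (H - 1))
    (hw : ∀ s, s ≤ 2 → ω (j + s) = tpath w6C1 2 xm H fwd s) (hwnd : j + 2 ≤ n) :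
    Splice6OK n 2 ω j (tpath offC1 8 xm H fwd) := by
  refine splice6OK_of_tables (L := 2) (w := w6C1) (by norm_num) (by rfl) (by rfl) (fun s hs => offC1_adj hx hpar hs)
    (fun s s' hs hs' h => offC1_inj hs hs' h) (fun u hu0 hu1 i hi _ => ?_) (fun u hu => ?_) hw hwnd
  · interval_cases u <;> simp only [offC1] <;>
      first | exact ne_of_high hmaxH hmaxX (by omega) hi | (rw [show xm + 2 = 4 by omega, show H + -1 = H - 1 by ring]; exact fun h => hC i hi h.symm)
  · interval_cases u <;> simp only [offC1] <;> exact s6_lexNonneg_pt (by omega)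

/-- **Case C2 surgery is admissible** (`xm = 2`; all new interior sites lie above the top row or right of the top corner).
[cite: MadrasSlade1993, §3.2 (proof of Theorem 3.2.3: local surgery)] -/
theorem spliceOK_C2 (hpar : (xm + H) % 2 = 1) (hx : xm = 2) (hH : 1 ≤ H)
    (hmaxH : ∀ i, i ≤ n → ω i 1 ≤ H) (hmaxX : ∀ i, i ≤ n → ω i 1 = H → ω i 0 ≤ xm)
    (hw : ∀ s, s ≤ 4 → ω (j + s) = tpath w6C2 4 xm H fwd s) (hwnd : j + 4 ≤ n) :
    Splice6OK n 4 ω j (tpath offC2 10 xm H fwd) := by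
  refine splice6OK_of_tables (L := 4) (w := w6C2) (by norm_num) (by rfl) (by rfl) (fun s hs => offC2_adj hx hpar hs)
    (fun s s' hs hs' h => offC2_inj hs hs' h) (fun u hu0 hu1 i hi _ => ?_) (fun u hu => ?_) hw hwnd
  · interval_cases u <;> simp only [offC2] <;> exact ne_of_high hmaxH hmaxX (by omega) hi
  · interval_cases u <;> simp only [offC2] <;> exact s6_lexNonneg_pt (by omega)

/-- **Case C0 surgery is admissible** (`xm = 2`; `(xm+1, H−1)` and `(xm+2, H−1)` are NOT sites of `ω` — true for the hexagon).
[cite: MadrasSlade1993, §3.2 (proof of Theorem 3.2.3: local surgery)] -/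
theorem spliceOK_C0 (hpar : (xm + H) % 2 = 1) (hx : xm = 2)
    (hmaxH : ∀ i, i ≤ n → ω i 1 ≤ H) (hmaxX : ∀ i, i ≤ n → ω i 1 = H → ω i 0 ≤ xm)
    (hC : ∀ i, i ≤ n → ω i ≠ pt (xm + 1) (H - 1) ∧ ω i ≠ pt (xm + 2) (H - 1))
    (hw : ∀ s, s ≤ 2 → ω (j + s) = tpath w6C0 2 xm H fwd s) (hwnd : j + 2 ≤ n) :
    Splice6OK n 2 ω j (tpath offC0 8 xm H fwd) := by
  refine splice6OK_of_tables (L := 2) (w := w6C0) (by norm_num) (by rfl) (by rfl) (fun s hs => offC0_adj hpar hs)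
    (fun s s' hs hs' h => offC0_inj hs hs' h) (fun u hu0 hu1 i hi _ => ?_) (fun u hu => ?_) hw hwnd
  · interval_cases u <;> simp only [offC0] <;> first | exact ne_of_high hmaxH hmaxX (by omega) hi | (rw [show H + -1 = H - 1 by ring]; exact fun h => (hC i hi).1 h.symm) | (rw [show H + -1 = H - 1 by ring]; exact fun h => (hC i hi).2 h.symm)
  · interval_cases u <;> simp only [offC0] <;> exact s6_lexNonneg_pt (by omega)

end Cases

/-! ### Polygon bonds (direction-free local structure) and windows -/

section Bonds

/-- `{a, b}` is a WALK bond of `ω` (some `{ω i, ω (i+1)}`, `i < n`; the closing bond `{e₀, 0}` is not included).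
[cite: MadrasSlade1993, §3.2 (proof of Theorem 3.2.3)] -/
def SixPB (n : ℕ) (ω : ℕ → Site 2) (a b : Site 2) : Prop := ∃ i, i < n ∧ ((ω i = a ∧ ω (i + 1) = b) ∨ (ω i = b ∧ ω (i + 1) = a))

/-- `SixPB` is symmetric. [cite: MadrasSlade1993, §3.2] -/
theorem SixPB.symm {a b : Site 2} (h : SixPB n ω a b) : SixPB n ω b a := by
  obtain ⟨i, hi, h⟩ := h; exact ⟨i, hi, h.symm⟩

/-- The walk-neighbours of an interior time are bonds. [cite: MadrasSlade1993, §3.2] -/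
theorem pb_pred {i : ℕ} (hi1 : 1 ≤ i) (hi : i ≤ n) : SixPB n ω (ω i) (ω (i - 1)) :=
  ⟨i - 1, by omega, Or.inr ⟨rfl, by rw [show i - 1 + 1 = i by omega]⟩⟩

/-- The walk-neighbours of an interior time are bonds. [cite: MadrasSlade1993, §3.2] -/
theorem pb_succ {i : ℕ} (hi : i + 1 ≤ n) : SixPB n ω (ω i) (ω (i + 1)) := ⟨i, by omega, Or.inl ⟨rfl, rfl⟩⟩

/-- **A bond at an interior site is one of its two walk bonds**: if `{ω i, b}` is a walk bond and `1 ≤ i ≤ n − 1`, then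
`b = ω (i−1)` or `b = ω (i+1)`. [cite: MadrasSlade1993, §3.2 (proof of Theorem 3.2.3)] -/
theorem pb_cases (hω : ω ∈ endAt n (Pi.single 0 1 : Site 2)) {i : ℕ} (hi1 : 1 ≤ i) (hi : i + 1 ≤ n) {b : Site 2}
    (h : SixPB n ω (ω i) b) : b = ω (i - 1) ∨ b = ω (i + 1) := by
  obtain ⟨k, hk, hkb⟩ := h
  rcases hkb with ⟨h1, h2⟩ | ⟨h1, h2⟩
  · have := inj_of_mem hω (by omega) (by omega) h1; subst this; exact Or.inr h2.symm
  · have := inj_of_mem hω (by omega) (by omega) h2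
    left
    rw [← h1]; congr 1; omega

/-- A bond at the root `ω 0 = 0` other than the closing one is `{0, ω 1}`. [cite: MadrasSlade1993, §3.2] -/
theorem pb_zero (hω : ω ∈ endAt n (Pi.single 0 1 : Site 2)) (hn : 1 ≤ n) {b : Site 2} (h : SixPB n ω (ω 0) b) : b = ω 1 := by
  obtain ⟨k, hk, hkb⟩ := h
  rcases hkb with ⟨h1, h2⟩ | ⟨h1, h2⟩
  · have := inj_of_mem hω (by omega) (by omega) h1; subst this; exact h2.symm
  · have := inj_of_mem hω (by omega) (by omega) h2; omega

/-- Three distinct bonds at one interior site are impossible. [cite: MadrasSlade1993, §3.2 (a polygon has degree two)] -/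
theorem pb_two (hω : ω ∈ endAt n (Pi.single 0 1 : Site 2)) {i : ℕ} (hi1 : 1 ≤ i) (hi : i + 1 ≤ n) {a b c : Site 2}
    (ha : SixPB n ω (ω i) a) (hb : SixPB n ω (ω i) b) (hc : SixPB n ω (ω i) c) (hab : a ≠ b) (hbc : b ≠ c) (hac : a ≠ c) : False := by
  rcases pb_cases hω hi1 hi ha with rfl | rfl <;> rcases pb_cases hω hi1 hi hb with rfl | rfl <;>
    rcases pb_cases hω hi1 hi hc with rfl | rfl
  all_goals first | exact hab rfl | exact hbc rfl | exact hac rfl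

/-- **From two consecutive bonds to a window**: if `{ω i, b}` and `{b, c}`… — elementary form used below: a bond `{ω i, b}` with
`b ≠ ω (i+1)` forces `b = ω (i−1)` (and `1 ≤ i`). [cite: MadrasSlade1993, §3.2 (proof of Theorem 3.2.3)] -/
theorem pb_eq_pred (hω : ω ∈ endAt n (Pi.single 0 1 : Site 2)) {i : ℕ} (hi : i + 1 ≤ n) {b : Site 2}
    (h : SixPB n ω (ω i) b) (hne : b ≠ ω (i + 1)) : 1 ≤ i ∧ b = ω (i - 1) := by
  rcases Nat.eq_zero_or_pos i with rfl | hi1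
  · exact absurd (pb_zero hω (by omega) h) hne
  · rcases pb_cases hω hi1 hi h with h' | h'
    · exact ⟨hi1, h'⟩
    · exact absurd h' hne

/-- Symmetric form: a bond `{ω i, b}` with `b ≠ ω (i−1)` (and `1 ≤ i`) forces `b = ω (i+1)` and `i + 1 ≤ n`.
[cite: MadrasSlade1993, §3.2 (proof of Theorem 3.2.3)] -/
theorem pb_eq_succ (hω : ω ∈ endAt n (Pi.single 0 1 : Site 2)) {i : ℕ} (hi1 : 1 ≤ i) (hi : i ≤ n) {b : Site 2}
    (h : SixPB n ω (ω i) b) (hne : b ≠ ω (i - 1)) : i + 1 ≤ n ∧ b = ω (i + 1) := by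
  obtain ⟨k, hk, hkb⟩ := h
  rcases hkb with ⟨h1, h2⟩ | ⟨h1, h2⟩
  · have := inj_of_mem hω (by omega) (by omega) h1; subst this; exact ⟨by omega, h2.symm⟩
  · have := inj_of_mem hω (by omega) (by omega) h2
    exfalso; apply hne; rw [← h1]; congr 1; omega

end Bonds

/-! ### Local structure below and left of the top corner (forward orientation) -/

section LocalFwd

variable {H xm : ℤ} {i₀ : ℕ}

/-- **Case A, forward**: if `(xm−3, H)` is a site of `ω` at all, it is `ω (i₀−3)` (the top run continues to the left): its only possible
walk-neighbours are `(xm−4, H)` and `(xm−2, H) = ω (i₀−2)` (up is too high, down is not a brick-wall bond).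
[cite: EntingJensen2009, §7.4.2, Fig. 7.10 (brickwork form of the honeycomb lattice)] -/
theorem caseA_fwd (hω : ω ∈ endAt n (Pi.single 0 1 : Site 2)) (hpar : (xm + H) % 2 = 1) (hH : 1 ≤ H)
    (hmaxH : ∀ i, i ≤ n → ω i 1 ≤ H) (hi₀ : 2 ≤ i₀) (hi₀n : i₀ + 1 ≤ n)
    (h2 : ω (i₀ - 2) = pt (xm - 2) H) (h1 : ω (i₀ - 1) = pt (xm - 1) H)
    {t : ℕ} (ht : t ≤ n) (hωt : ω t = pt (xm - 3) H) : 3 ≤ i₀ ∧ ω (i₀ - 3) = pt (xm - 3) H := by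
  obtain ⟨⟨h0, -, hbw, hinj⟩, hn'⟩ := mem_endAt_iff.1 hω
  -- `t` is interior: heights of `ω 0`, `ω n` are `0 < H`
  have ht0 : t ≠ 0 := by rintro rfl; rw [h0] at hωt; have := congrFun hωt 1; simp at this; omega
  have htn : t ≠ n := by rintro rfl; rw [hn'] at hωt; have := congrFun hωt 1; simp at this; omega
  -- both walk-neighbours of `ω t` are horizontal neighbours
  have key : ∀ z : Site 2, brickWallGraph.Adj (ω t) z → (∃ i, i ≤ n ∧ ω i = z) →
      z = pt (xm - 4) H ∨ z = pt (xm - 2) H := by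
    intro z hadj ⟨i, hi, hiz⟩
    have hzH : z 1 ≤ H := by rw [← hiz]; exact hmaxH i hi
    rw [hωt] at hadj
    rcases adj_cases hadj with ⟨hz0, hz1⟩ | ⟨hz0, hz1⟩ | hz0
    · right; rw [s6_site_eq_iff]; simp only [pt_apply_zero, pt_apply_one] at hz0 hz1 ⊢; omega
    · left; rw [s6_site_eq_iff]; simp only [pt_apply_zero, pt_apply_one] at hz0 hz1 ⊢; omega
    · exfalso
      rcases vertical_cases hadj hz0 with ⟨hy, hp⟩ | ⟨hy, hp⟩
      · simp only [pt_apply_one] at hy; omega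
      · simp only [pt_apply_zero, pt_apply_one] at hy hp hz0; omega
  have hp := key _ (by have := hbw (t - 1) (by omega); rw [show t - 1 + 1 = t by omega] at this; exact this.symm) ⟨t - 1, by omega, rfl⟩
  have hs := key _ (hbw t (by omega)) ⟨t + 1, by omega, rfl⟩
  have hne : ω (t - 1) ≠ ω (t + 1) := by
    intro h; have := hinj (show t - 1 ∈ {i | i ≤ n} by simp; omega) (show t + 1 ∈ {i | i ≤ n} by simp; omega) h; omega
  -- one of them is `(xm-2, H) = ω (i₀-2)`
  have hx : ω (t - 1) = ω (i₀ - 2) ∨ ω (t + 1) = ω (i₀ - 2) := by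
    rw [h2]
    rcases hp with hp | hp <;> rcases hs with hs | hs
    · exact absurd (hp.trans hs.symm) hne
    · exact Or.inr hs
    · exact Or.inl hp
    · exact absurd (hp.trans hs.symm) hne
  rcases hx with hx | hx
  · have := hinj (show t - 1 ∈ {i | i ≤ n} by simp; omega) (show i₀ - 2 ∈ {i | i ≤ n} by simp; omega) hx
    -- `t = i₀ - 1`: but `ω (i₀-1) = (xm-1, H) ≠ (xm-3, H)`
    have ht' : t = i₀ - 1 := by omega
    rw [ht', h1] at hωt; have := (pt_inj.1 hωt).1; omega
  · have := hinj (show t + 1 ∈ {i | i ≤ n} by simp; omega) (show i₀ - 2 ∈ {i | i ≤ n} by simp; omega) hx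
    have ht' : t = i₀ - 3 := by omega
    refine ⟨by omega, ?_⟩; rw [← ht']; exact hωt

/-- **Case C, forward, first step below the corner** (`xm = 2`): `ω (i₀+2)` is `(1, H−1)` or `(3, H−1)` (and `i₀ + 2 ≤ n`).
[cite: EntingJensen2009, §7.4.2, Fig. 7.10] -/
theorem caseC_fwd_step (hω : ω ∈ endAt n (Pi.single 0 1 : Site 2)) (hpar : (xm + H) % 2 = 1) (hx : xm = 2)
    (_hi₀ : 1 ≤ i₀) (hi₀n : i₀ + 1 ≤ n) (hv : ω i₀ = pt xm H) (hs : ω (i₀ + 1) = pt xm (H - 1)) :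
    i₀ + 2 ≤ n ∧ (ω (i₀ + 2) = pt 1 (H - 1) ∨ ω (i₀ + 2) = pt 3 (H - 1)) := by
  obtain ⟨⟨h0, -, hbw, hinj⟩, hn'⟩ := mem_endAt_iff.1 hω
  have hne : i₀ + 1 ≠ n := by
    intro h; rw [h, hn'] at hs; have := congrFun hs 0; simp at this; omega
  refine ⟨by omega, ?_⟩
  have hadj : brickWallGraph.Adj (ω (i₀ + 1)) (ω (i₀ + 2)) := hbw (i₀ + 1) (by omega)
  rw [hs] at hadj
  have hback : ω (i₀ + 2) ≠ ω i₀ := by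
    intro h; have := hinj (show i₀ + 2 ∈ {i | i ≤ n} by simp; omega) (show i₀ ∈ {i | i ≤ n} by simp; omega) h; omega
  rcases adj_cases hadj with ⟨hz0, hz1⟩ | ⟨hz0, hz1⟩ | hz0
  · right; rw [s6_site_eq_iff]; simp only [pt_apply_zero, pt_apply_one] at hz0 hz1 ⊢; omega
  · left; rw [s6_site_eq_iff]; simp only [pt_apply_zero, pt_apply_one] at hz0 hz1 ⊢; omega
  · exfalso
    rcases vertical_cases hadj hz0 with ⟨hy, hp⟩ | ⟨hy, hp⟩
    · -- up: back to `ω i₀`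
      apply hback; rw [hv, s6_site_eq_iff]; simp only [pt_apply_zero, pt_apply_one] at hz0 hy ⊢; omega
    · -- down: no bond (parity)
      simp only [pt_apply_zero, pt_apply_one] at hz0 hy hp; omega

/-- **Case C2, forward**: with `ω (i₀+2) = (3, H−1)`, if `(4, H−1)` is a site of `ω` at all, it is `ω (i₀+3)` (its only possible
walk-neighbours are `(3, H−1)` and `(5, H−1)`: the site `(4, H)` above it is right of the top corner, the bond below it does not exist).
[cite: EntingJensen2009, §7.4.2, Fig. 7.10] -/
theorem caseC2_fwd (hω : ω ∈ endAt n (Pi.single 0 1 : Site 2)) (hpar : (xm + H) % 2 = 1) (hx : xm = 2) (_hH : 1 ≤ H)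
    (hmaxH : ∀ i, i ≤ n → ω i 1 ≤ H) (hmaxX : ∀ i, i ≤ n → ω i 1 = H → ω i 0 ≤ xm)
    (hi₀n : i₀ + 2 ≤ n) (hs : ω (i₀ + 1) = pt xm (H - 1)) (hs2 : ω (i₀ + 2) = pt 3 (H - 1))
    {t : ℕ} (ht : t ≤ n) (hωt : ω t = pt 4 (H - 1)) : i₀ + 3 ≤ n ∧ ω (i₀ + 3) = pt 4 (H - 1) := by
  obtain ⟨⟨h0, -, hbw, hinj⟩, hn'⟩ := mem_endAt_iff.1 hω
  have htn : t ≠ n := by rintro rfl; rw [hn'] at hωt; have := congrFun hωt 0; simp at this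
  have ht0 : t ≠ 0 := by rintro rfl; rw [h0] at hωt; have := congrFun hωt 0; simp at this
  have key : ∀ z : Site 2, brickWallGraph.Adj (ω t) z → (∃ i, i ≤ n ∧ ω i = z) →
      z = pt 3 (H - 1) ∨ z = pt 5 (H - 1) := by
    intro z hadj ⟨i, hi, hiz⟩
    rw [hωt] at hadj
    rcases adj_cases hadj with ⟨hz0, hz1⟩ | ⟨hz0, hz1⟩ | hz0
    · right; rw [s6_site_eq_iff]; simp only [pt_apply_zero, pt_apply_one] at hz0 hz1 ⊢; omega
    · left; rw [s6_site_eq_iff]; simp only [pt_apply_zero, pt_apply_one] at hz0 hz1 ⊢; omega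
    · exfalso
      rcases vertical_cases hadj hz0 with ⟨hy, hp⟩ | ⟨hy, hp⟩
      · -- up to `(4, H)`: height `H`, abscissa `4 > xm`
        have h1 := hmaxX i hi (by rw [hiz]; simp only [pt_apply_one] at hy; omega)
        rw [hiz] at h1; simp only [pt_apply_zero] at hz0; omega
      · simp only [pt_apply_zero, pt_apply_one] at hz0 hy hp; omega
  have hp := key _ (by have := hbw (t - 1) (by omega); rw [show t - 1 + 1 = t by omega] at this; exact this.symm) ⟨t - 1, by omega, rfl⟩
  have hsu := key _ (hbw t (by omega)) ⟨t + 1, by omega, rfl⟩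
  have hne : ω (t - 1) ≠ ω (t + 1) := by
    intro h; have := hinj (show t - 1 ∈ {i | i ≤ n} by simp; omega) (show t + 1 ∈ {i | i ≤ n} by simp; omega) h; omega
  have hx3 : ω (t - 1) = ω (i₀ + 2) ∨ ω (t + 1) = ω (i₀ + 2) := by
    rw [hs2]
    rcases hp with hp | hp <;> rcases hsu with hsu | hsu
    · exact absurd (hp.trans hsu.symm) hne
    · exact Or.inl hp
    · exact Or.inr hsu
    · exact absurd (hp.trans hsu.symm) hne
  rcases hx3 with h3 | h3
  · have := hinj (show t - 1 ∈ {i | i ≤ n} by simp; omega) (show i₀ + 2 ∈ {i | i ≤ n} by simp; omega) h3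
    have ht' : t = i₀ + 3 := by omega
    exact ⟨by omega, by rw [← ht']; exact hωt⟩
  · have := hinj (show t + 1 ∈ {i | i ≤ n} by simp; omega) (show i₀ + 2 ∈ {i | i ≤ n} by simp; omega) h3
    -- `t = i₀ + 1`: but `ω (i₀+1) = (2, H-1) ≠ (4, H-1)`
    have ht' : t = i₀ + 1 := by omega
    rw [ht', hs] at hωt; have := (pt_inj.1 hωt).1; omega

end LocalFwd

/-! ### Case C0 (forward): the hexagon -/

section HexagonCase

variable {H xm : ℤ} {i₀ : ℕ}

/-- **Case C0 forces the hexagon**: with `xm = 2`, the forward top corner at `i₀` and `ω (i₀+2) = (1, H−1)`, the polygon closes up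
around the single brick `[0,2]×[H−1,H]`: `i₀ = 3`, `H = 1`, `n = 5`. [cite: EntingJensen2009, §7.4.2, Fig. 7.10] -/
theorem caseC0_fwd (hω : ω ∈ canonEnd n) (_hn : 2 ≤ n) (hpar : (xm + H) % 2 = 1) (hx : xm = 2) (_hH : 1 ≤ H)
    (hi₀ : 2 ≤ i₀) (hi₀n : i₀ + 2 ≤ n) (h2 : ω (i₀ - 2) = pt (xm - 2) H) (h1 : ω (i₀ - 1) = pt (xm - 1) H)
    (_hs : ω (i₀ + 1) = pt xm (H - 1)) (hs2 : ω (i₀ + 2) = pt 1 (H - 1)) : i₀ = 3 ∧ H = 1 ∧ n = 5 := by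
  obtain ⟨hE, hlex⟩ := mem_canonEnd.1 hω
  obtain ⟨⟨h0, -, hbw, hinj⟩, hn'⟩ := mem_endAt_iff.1 hE
  have hcol := col_nonneg_of_mem_canonEnd hω
  -- `i₀ ≥ 3`: `ω (i₀ - 2) = (0, H)` is not the root (`H ≥ 1`)
  have hi₀3 : 3 ≤ i₀ := by
    by_contra hlt
    have : i₀ - 2 = 0 := by omega
    rw [this, h0] at h2; have := congrFun h2 1; simp at this; omega
  -- `ω (i₀ - 3) = (0, H - 1)`
  have hadj3 : brickWallGraph.Adj (ω (i₀ - 2)) (ω (i₀ - 3)) := by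
    have := hbw (i₀ - 3) (by omega); rw [show i₀ - 3 + 1 = i₀ - 2 by omega] at this; exact this.symm
  have hne31 : ω (i₀ - 3) ≠ ω (i₀ - 1) := by
    intro h; have := hinj (show i₀ - 3 ∈ {i | i ≤ n} by simp; omega) (show i₀ - 1 ∈ {i | i ≤ n} by simp; omega) h; omega
  have h3 : ω (i₀ - 3) = pt 0 (H - 1) := by
    rw [h2] at hadj3
    have hx0 := hcol (i₀ - 3)
    rcases adj_cases hadj3 with ⟨hz0, hz1⟩ | ⟨hz0, hz1⟩ | hz0
    · exfalso; apply hne31; rw [h1, s6_site_eq_iff]; simp only [pt_apply_zero, pt_apply_one] at hz0 hz1 ⊢; omega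
    · simp only [pt_apply_zero] at hz0; omega
    · rcases vertical_cases hadj3 hz0 with ⟨hy, hp⟩ | ⟨hy, hp⟩
      · simp only [pt_apply_zero, pt_apply_one] at hp; omega
      · rw [s6_site_eq_iff]; simp only [pt_apply_zero, pt_apply_one] at hz0 hy ⊢; omega
  -- `i₀ = 3`: otherwise `ω (i₀ - 4)` would be a fourth neighbour of `(0, H-1)`
  have hi₀eq : i₀ = 3 := by
    by_contra hne
    have hi₀4 : 4 ≤ i₀ := by omega
    have hadj4 : brickWallGraph.Adj (ω (i₀ - 3)) (ω (i₀ - 4)) := by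
      have := hbw (i₀ - 4) (by omega); rw [show i₀ - 4 + 1 = i₀ - 3 by omega] at this; exact this.symm
    have hneA : ω (i₀ - 4) ≠ ω (i₀ + 2) := by
      intro h; have := hinj (show i₀ - 4 ∈ {i | i ≤ n} by simp; omega) (show i₀ + 2 ∈ {i | i ≤ n} by simp; omega) h; omega
    have hneB : ω (i₀ - 4) ≠ ω (i₀ - 2) := by
      intro h; have := hinj (show i₀ - 4 ∈ {i | i ≤ n} by simp; omega) (show i₀ - 2 ∈ {i | i ≤ n} by simp; omega) h; omega
    have hx0 := hcol (i₀ - 4)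
    rw [h3] at hadj4
    rcases adj_cases hadj4 with ⟨hz0, hz1⟩ | ⟨hz0, hz1⟩ | hz0
    · apply hneA; rw [hs2, s6_site_eq_iff]; simp only [pt_apply_zero, pt_apply_one] at hz0 hz1 ⊢; omega
    · simp only [pt_apply_zero] at hz0; omega
    · rcases vertical_cases hadj4 hz0 with ⟨hy, hp⟩ | ⟨hy, hp⟩
      · apply hneB; rw [h2, s6_site_eq_iff]; simp only [pt_apply_zero, pt_apply_one] at hz0 hy ⊢; omega
      · simp only [pt_apply_zero, pt_apply_one] at hz0 hy hp; omega
  -- `H = 1`: `ω 0 = (0, H - 1) = 0`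
  have hH1 : H = 1 := by
    rw [hi₀eq] at h3; simp only [show 3 - 3 = 0 from rfl, h0] at h3
    have := congrFun h3 1; simp at this; omega
  -- `n = 5`: `ω (i₀ + 2) = (1, 0) = e₀ = ω n`
  have hn5 : n = 5 := by
    have he : ω (i₀ + 2) = ω n := by
      rw [hs2, hn', hH1]; funext l; fin_cases l <;> simp [pt]
    have := hinj (show i₀ + 2 ∈ {i | i ≤ n} by simp; omega) (show n ∈ {i | i ≤ n} by simp) he
    omega
  exact ⟨hi₀eq, hH1, hn5⟩

/-- In case C0 every site of the polygon is one of the six hexagon sites; in particular `(3, 0)` and `(4, 0)` are not visited.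
[cite: EntingJensen2009, §7.4.2, Fig. 7.10] -/
theorem caseC0_free (hω : ω ∈ canonEnd n) (hn5 : n = 5) (h0' : ω 0 = pt 0 0) (h1' : ω 1 = pt 0 1) (h2' : ω 2 = pt 1 1)
    (h3' : ω 3 = pt 2 1) (h4' : ω 4 = pt 2 0) (h5' : ω 5 = pt 1 0) :
    ∀ i, i ≤ n → ω i ≠ pt (2 + 1) (1 - 1) ∧ ω i ≠ pt (2 + 2) (1 - 1) := by
  intro i hi
  subst hn5
  interval_cases i <;> simp only [h0', h1', h2', h3', h4', h5'] <;>
    exact ⟨fun h => by have := (pt_inj.1 h).1; omega, fun h => by have := (pt_inj.1 h).1; omega⟩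

end HexagonCase

/-! ### Local structure, backward orientation (mirror in time of the forward lemmas) -/

section LocalBwd

variable {H xm : ℤ} {i₀ : ℕ}

/-- Backward form of `top_corner_pred`: if `ω (i₀+1) = (xm−1, H)` then `i₀ + 2 ≤ n` and `ω (i₀+2) = (xm−2, H)`.
[cite: EntingJensen2009, §7.4.2, Fig. 7.10] -/
theorem top_corner_succ (hω : ω ∈ canonEnd n) {H xm : ℤ} {i₀ : ℕ} (hi₀ : 1 ≤ i₀) (hi₀n : i₀ + 1 ≤ n)
    (hv : ω i₀ = pt xm H) (hmaxH : ∀ i, i ≤ n → ω i 1 ≤ H)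
    (hs : ω (i₀ + 1) = pt (xm - 1) H) (hp : ω (i₀ - 1) = pt xm (H - 1)) :
    i₀ + 2 ≤ n ∧ ω (i₀ + 2) = pt (xm - 2) H := by
  obtain ⟨hE, hlex⟩ := mem_canonEnd.1 hω
  obtain ⟨⟨h0, -, hbw, hinj⟩, hn'⟩ := mem_endAt_iff.1 hE
  have hvert := vertical_cases (hbw (i₀ - 1) (by omega)) (by rw [show i₀ - 1 + 1 = i₀ by omega, hv, hp]; simp)
  have hpar : (xm + (H - 1)) % 2 = 0 := by
    rw [show i₀ - 1 + 1 = i₀ by omega, hv, hp] at hvert; simp only [pt_apply_zero, pt_apply_one] at hvert; omega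
  -- `i₀ + 1 ≠ n`: `ω n = (1,0)` has height `0 < 1 ≤ H`
  have hH1 : 1 ≤ H := by
    have h1 := apply_one_of_mem_canonEnd hω (by omega)
    have := hmaxH 1 (by omega); rw [h1.2] at this; exact this
  have hi₀2 : i₀ + 2 ≤ n := by
    by_contra hlt
    have hi : i₀ + 1 = n := by omega
    rw [hi, hn'] at hs
    have := congrFun hs 1; simp at this; omega
  refine ⟨hi₀2, ?_⟩
  have hadj : brickWallGraph.Adj (ω (i₀ + 1)) (ω (i₀ + 2)) := hbw (i₀ + 1) (by omega)
  have hne : ω (i₀ + 2) ≠ ω i₀ := by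
    intro h
    have := hinj (show i₀ + 2 ∈ {i | i ≤ n} by simp; omega) (show i₀ ∈ {i | i ≤ n} by simp; omega) h
    omega
  have hzH : ω (i₀ + 2) 1 ≤ H := hmaxH _ (by omega)
  rw [hs] at hadj
  rcases adj_cases hadj with ⟨h1', h2'⟩ | ⟨h1', h2'⟩ | h1'
  · exfalso; apply hne; rw [hv, s6_site_eq_iff]; simp only [pt_apply_zero, pt_apply_one] at h1' h2' ⊢; exact ⟨by omega, by omega⟩
  · rw [s6_site_eq_iff]; simp only [pt_apply_zero, pt_apply_one] at h1' h2' ⊢; exact ⟨by omega, by omega⟩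
  · exfalso
    rcases vertical_cases hadj h1' with ⟨hy, hpar'⟩ | ⟨hy, hpar'⟩
    · simp only [pt_apply_one] at hy; omega
    · simp only [pt_apply_zero, pt_apply_one] at hy hpar' h1'; omega

/-- **Case A, backward**: if `(xm−3, H)` is a site of `ω` then it is `ω (i₀+3)`. [cite: EntingJensen2009, §7.4.2, Fig. 7.10] -/
theorem caseA_bwd (hω : ω ∈ endAt n (Pi.single 0 1 : Site 2)) (hpar : (xm + H) % 2 = 1) (hH : 1 ≤ H)
    (hmaxH : ∀ i, i ≤ n → ω i 1 ≤ H) (hi₀n : i₀ + 2 ≤ n)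
    (h2 : ω (i₀ + 2) = pt (xm - 2) H) (h1 : ω (i₀ + 1) = pt (xm - 1) H)
    {t : ℕ} (ht : t ≤ n) (hωt : ω t = pt (xm - 3) H) : i₀ + 3 ≤ n ∧ ω (i₀ + 3) = pt (xm - 3) H := by
  obtain ⟨⟨h0, -, hbw, hinj⟩, hn'⟩ := mem_endAt_iff.1 hω
  have ht0 : t ≠ 0 := by rintro rfl; rw [h0] at hωt; have := congrFun hωt 1; simp at this; omega
  have htn : t ≠ n := by rintro rfl; rw [hn'] at hωt; have := congrFun hωt 1; simp at this; omega
  have key : ∀ z : Site 2, brickWallGraph.Adj (ω t) z → (∃ i, i ≤ n ∧ ω i = z) →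
      z = pt (xm - 4) H ∨ z = pt (xm - 2) H := by
    intro z hadj ⟨i, hi, hiz⟩
    have hzH : z 1 ≤ H := by rw [← hiz]; exact hmaxH i hi
    rw [hωt] at hadj
    rcases adj_cases hadj with ⟨hz0, hz1⟩ | ⟨hz0, hz1⟩ | hz0
    · right; rw [s6_site_eq_iff]; simp only [pt_apply_zero, pt_apply_one] at hz0 hz1 ⊢; omega
    · left; rw [s6_site_eq_iff]; simp only [pt_apply_zero, pt_apply_one] at hz0 hz1 ⊢; omega
    · exfalso
      rcases vertical_cases hadj hz0 with ⟨hy, hp⟩ | ⟨hy, hp⟩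
      · simp only [pt_apply_one] at hy; omega
      · simp only [pt_apply_zero, pt_apply_one] at hy hp hz0; omega
  have hp := key _ (by have := hbw (t - 1) (by omega); rw [show t - 1 + 1 = t by omega] at this; exact this.symm) ⟨t - 1, by omega, rfl⟩
  have hs := key _ (hbw t (by omega)) ⟨t + 1, by omega, rfl⟩
  have hne : ω (t - 1) ≠ ω (t + 1) := by
    intro h; have := hinj (show t - 1 ∈ {i | i ≤ n} by simp; omega) (show t + 1 ∈ {i | i ≤ n} by simp; omega) h; omega
  have hx : ω (t - 1) = ω (i₀ + 2) ∨ ω (t + 1) = ω (i₀ + 2) := by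
    rw [h2]
    rcases hp with hp | hp <;> rcases hs with hs | hs
    · exact absurd (hp.trans hs.symm) hne
    · exact Or.inr hs
    · exact Or.inl hp
    · exact absurd (hp.trans hs.symm) hne
  rcases hx with hx | hx
  · have := hinj (show t - 1 ∈ {i | i ≤ n} by simp; omega) (show i₀ + 2 ∈ {i | i ≤ n} by simp; omega) hx
    have ht' : t = i₀ + 3 := by omega
    exact ⟨by omega, by rw [← ht']; exact hωt⟩
  · have := hinj (show t + 1 ∈ {i | i ≤ n} by simp; omega) (show i₀ + 2 ∈ {i | i ≤ n} by simp; omega) hx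
    have ht' : t = i₀ + 1 := by omega
    rw [ht', h1] at hωt; have := (pt_inj.1 hωt).1; omega

/-- **Case C, backward, first step below the corner** (`xm = 2`): `ω (i₀−2)` is `(1, H−1)` or `(3, H−1)` (and `2 ≤ i₀`).
[cite: EntingJensen2009, §7.4.2, Fig. 7.10] -/
theorem caseC_bwd_step (hω : ω ∈ endAt n (Pi.single 0 1 : Site 2)) (hpar : (xm + H) % 2 = 1) (hx : xm = 2)
    (hi₀ : 1 ≤ i₀) (hi₀n : i₀ + 1 ≤ n) (hv : ω i₀ = pt xm H) (hp : ω (i₀ - 1) = pt xm (H - 1)) :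
    2 ≤ i₀ ∧ (ω (i₀ - 2) = pt 1 (H - 1) ∨ ω (i₀ - 2) = pt 3 (H - 1)) := by
  obtain ⟨⟨h0, -, hbw, hinj⟩, hn'⟩ := mem_endAt_iff.1 hω
  have hne : i₀ - 1 ≠ 0 := by
    intro h; rw [h, h0] at hp; have := congrFun hp 0; simp at this; omega
  refine ⟨by omega, ?_⟩
  have hadj : brickWallGraph.Adj (ω (i₀ - 1)) (ω (i₀ - 2)) := by
    have := hbw (i₀ - 2) (by omega); rw [show i₀ - 2 + 1 = i₀ - 1 by omega] at this; exact this.symm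
  rw [hp] at hadj
  have hback : ω (i₀ - 2) ≠ ω i₀ := by
    intro h; have := hinj (show i₀ - 2 ∈ {i | i ≤ n} by simp; omega) (show i₀ ∈ {i | i ≤ n} by simp; omega) h; omega
  rcases adj_cases hadj with ⟨hz0, hz1⟩ | ⟨hz0, hz1⟩ | hz0
  · right; rw [s6_site_eq_iff]; simp only [pt_apply_zero, pt_apply_one] at hz0 hz1 ⊢; omega
  · left; rw [s6_site_eq_iff]; simp only [pt_apply_zero, pt_apply_one] at hz0 hz1 ⊢; omega
  · exfalso
    rcases vertical_cases hadj hz0 with ⟨hy, hp'⟩ | ⟨hy, hp'⟩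
    · apply hback; rw [hv, s6_site_eq_iff]; simp only [pt_apply_zero, pt_apply_one] at hz0 hy ⊢; omega
    · simp only [pt_apply_zero, pt_apply_one] at hz0 hy hp'; omega

/-- **Case C2, backward**: with `ω (i₀−2) = (3, H−1)`, if `(4, H−1)` is a site of `ω` then it is `ω (i₀−3)`.
[cite: EntingJensen2009, §7.4.2, Fig. 7.10] -/
theorem caseC2_bwd (hω : ω ∈ endAt n (Pi.single 0 1 : Site 2)) (hpar : (xm + H) % 2 = 1) (hx : xm = 2)
    (hmaxX : ∀ i, i ≤ n → ω i 1 = H → ω i 0 ≤ xm)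
    (hi₀ : 2 ≤ i₀) (hi₀n : i₀ ≤ n) (hp : ω (i₀ - 1) = pt xm (H - 1)) (hp2 : ω (i₀ - 2) = pt 3 (H - 1))
    {t : ℕ} (ht : t ≤ n) (hωt : ω t = pt 4 (H - 1)) : 3 ≤ i₀ ∧ ω (i₀ - 3) = pt 4 (H - 1) := by
  obtain ⟨⟨h0, -, hbw, hinj⟩, hn'⟩ := mem_endAt_iff.1 hω
  have htn : t ≠ n := by rintro rfl; rw [hn'] at hωt; have := congrFun hωt 0; simp at this
  have ht0 : t ≠ 0 := by rintro rfl; rw [h0] at hωt; have := congrFun hωt 0; simp at this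
  have key : ∀ z : Site 2, brickWallGraph.Adj (ω t) z → (∃ i, i ≤ n ∧ ω i = z) →
      z = pt 3 (H - 1) ∨ z = pt 5 (H - 1) := by
    intro z hadj ⟨i, hi, hiz⟩
    rw [hωt] at hadj
    rcases adj_cases hadj with ⟨hz0, hz1⟩ | ⟨hz0, hz1⟩ | hz0
    · right; rw [s6_site_eq_iff]; simp only [pt_apply_zero, pt_apply_one] at hz0 hz1 ⊢; omega
    · left; rw [s6_site_eq_iff]; simp only [pt_apply_zero, pt_apply_one] at hz0 hz1 ⊢; omega
    · exfalso
      rcases vertical_cases hadj hz0 with ⟨hy, hq⟩ | ⟨hy, hq⟩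
      · have h1 := hmaxX i hi (by rw [hiz]; simp only [pt_apply_one] at hy; omega)
        rw [hiz] at h1; simp only [pt_apply_zero] at hz0; omega
      · simp only [pt_apply_zero, pt_apply_one] at hz0 hy hq; omega
  have hpr := key _ (by have := hbw (t - 1) (by omega); rw [show t - 1 + 1 = t by omega] at this; exact this.symm) ⟨t - 1, by omega, rfl⟩
  have hsu := key _ (hbw t (by omega)) ⟨t + 1, by omega, rfl⟩
  have hne : ω (t - 1) ≠ ω (t + 1) := by
    intro h; have := hinj (show t - 1 ∈ {i | i ≤ n} by simp; omega) (show t + 1 ∈ {i | i ≤ n} by simp; omega) h; omega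
  have hx3 : ω (t - 1) = ω (i₀ - 2) ∨ ω (t + 1) = ω (i₀ - 2) := by
    rw [hp2]
    rcases hpr with hpr | hpr <;> rcases hsu with hsu | hsu
    · exact absurd (hpr.trans hsu.symm) hne
    · exact Or.inl hpr
    · exact Or.inr hsu
    · exact absurd (hpr.trans hsu.symm) hne
  rcases hx3 with h3 | h3
  · have := hinj (show t - 1 ∈ {i | i ≤ n} by simp; omega) (show i₀ - 2 ∈ {i | i ≤ n} by simp; omega) h3
    -- `t = i₀ - 1`: but `ω (i₀-1) = (2, H-1)`
    have ht' : t = i₀ - 1 := by omega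
    rw [ht', hp] at hωt; have := (pt_inj.1 hωt).1; omega
  · have := hinj (show t + 1 ∈ {i | i ≤ n} by simp; omega) (show i₀ - 2 ∈ {i | i ≤ n} by simp; omega) h3
    have ht' : t = i₀ - 3 := by omega
    exact ⟨by omega, by rw [← ht']; exact hωt⟩

/-- **Case C0 cannot occur backwards**: with `xm = 2`, the backward top corner and `ω (i₀−2) = (1, H−1)`, the walk would have to close
up around the brick `[0,2]×[H−1,H]` against its orientation (the root's first step is UP). [cite: EntingJensen2009, §7.4.2, Fig. 7.10] -/
theorem caseC0_bwd_false (hω : ω ∈ canonEnd n) (hpar : (xm + H) % 2 = 1) (hx : xm = 2) (_hH : 1 ≤ H)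
    (hi₀ : 2 ≤ i₀) (hi₀n : i₀ + 2 ≤ n) (hs2 : ω (i₀ + 2) = pt (xm - 2) H) (hs1 : ω (i₀ + 1) = pt (xm - 1) H)
    (hp2 : ω (i₀ - 2) = pt 1 (H - 1)) : False := by
  obtain ⟨hE, hlex⟩ := mem_canonEnd.1 hω
  obtain ⟨⟨h0, -, hbw, hinj⟩, hn'⟩ := mem_endAt_iff.1 hE
  have hcol := col_nonneg_of_mem_canonEnd hω
  -- `i₀ + 2 ≠ n` (`ω n = (1,0)` has abscissa `1 ≠ 0`), so `ω (i₀+3)` exists and is `(0, H-1)`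
  have hi₀3 : i₀ + 3 ≤ n := by
    by_contra hlt
    have : i₀ + 2 = n := by omega
    rw [this, hn'] at hs2; have := congrFun hs2 0; simp at this; omega
  have hadj3 : brickWallGraph.Adj (ω (i₀ + 2)) (ω (i₀ + 3)) := hbw (i₀ + 2) (by omega)
  have hne31 : ω (i₀ + 3) ≠ ω (i₀ + 1) := by
    intro h; have := hinj (show i₀ + 3 ∈ {i | i ≤ n} by simp; omega) (show i₀ + 1 ∈ {i | i ≤ n} by simp; omega) h; omega
  have h3 : ω (i₀ + 3) = pt 0 (H - 1) := by
    rw [hs2] at hadj3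
    have hx0 := hcol (i₀ + 3)
    rcases adj_cases hadj3 with ⟨hz0, hz1⟩ | ⟨hz0, hz1⟩ | hz0
    · exfalso; apply hne31; rw [hs1, s6_site_eq_iff]; simp only [pt_apply_zero, pt_apply_one] at hz0 hz1 ⊢; omega
    · simp only [pt_apply_zero] at hz0; omega
    · rcases vertical_cases hadj3 hz0 with ⟨hy, hq⟩ | ⟨hy, hq⟩
      · simp only [pt_apply_zero, pt_apply_one] at hq; omega
      · rw [s6_site_eq_iff]; simp only [pt_apply_zero, pt_apply_one] at hz0 hy ⊢; omega
  -- `(0, H-1)` is not the endpoint `(1,0)`, so `ω (i₀+4)` exists; it has nowhere to go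
  have hi₀4 : i₀ + 4 ≤ n := by
    by_contra hlt
    have : i₀ + 3 = n := by omega
    rw [this, hn'] at h3; have := congrFun h3 0; simp at this
  have hadj4 : brickWallGraph.Adj (ω (i₀ + 3)) (ω (i₀ + 4)) := hbw (i₀ + 3) (by omega)
  have hneA : ω (i₀ + 4) ≠ ω (i₀ - 2) := by
    intro h; have := hinj (show i₀ + 4 ∈ {i | i ≤ n} by simp; omega) (show i₀ - 2 ∈ {i | i ≤ n} by simp; omega) h; omega
  have hneB : ω (i₀ + 4) ≠ ω (i₀ + 2) := by
    intro h; have := hinj (show i₀ + 4 ∈ {i | i ≤ n} by simp; omega) (show i₀ + 2 ∈ {i | i ≤ n} by simp; omega) h; omega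
  have hx0 := hcol (i₀ + 4)
  rw [h3] at hadj4
  rcases adj_cases hadj4 with ⟨hz0, hz1⟩ | ⟨hz0, hz1⟩ | hz0
  · apply hneA; rw [hp2, s6_site_eq_iff]; simp only [pt_apply_zero, pt_apply_one] at hz0 hz1 ⊢; omega
  · simp only [pt_apply_zero] at hz0; omega
  · rcases vertical_cases hadj4 hz0 with ⟨hy, hq⟩ | ⟨hy, hq⟩
    · apply hneB; rw [hs2, s6_site_eq_iff]; simp only [pt_apply_zero, pt_apply_one] at hz0 hy ⊢; omega
    · simp only [pt_apply_zero, pt_apply_one] at hz0 hy hq; omega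

end LocalBwd

/-! ### Assembly: every canonical polygon admits one of the five surgeries -/

section Assembly

/-- Evaluating a table path at an index (for window checks). [cite: MadrasSlade1993, §3.2] -/
theorem tpath_eq {w : ℕ → ℤ × ℤ} {L : ℕ} {xm H : ℤ} {fwd : Bool} {s : ℕ} {z : Site 2} {a b : ℤ}
    (hz : z = pt a b) (hu : w (rd fwd L s) = (a - xm, b - H)) : z = tpath w L xm H fwd s := by
  rw [hz, tpath, hu]; congr 1 <;> ring

/-- **Every canonical rooted polygon with `n ≥ 5` admits a `+6` top surgery** (one of the cases A, B, C1, C2, C0, in its own orientation).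
[cite: MadrasSlade1993, §3.2 (proof of Theorem 3.2.3: local surgery at the extreme point)] -/
theorem stepSix_exists (hω : ω ∈ canonEnd n) (hn : 5 ≤ n) :
    ∃ (L j : ℕ) (off : ℕ → ℤ × ℤ) (xm H : ℤ) (fwd : Bool), Splice6OK n L ω j (tpath off (L + 6) xm H fwd) := by
  obtain ⟨hE, hlex⟩ := mem_canonEnd.1 hω
  obtain ⟨⟨h0, -, hbw, hinj⟩, hn'⟩ := mem_endAt_iff.1 hE
  have hcol := col_nonneg_of_mem_canonEnd hω
  have h1 := apply_one_of_mem_canonEnd hω (by omega)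
  obtain ⟨H, xm, i₀, hi₀, hi₀n, hv, hH1, hmaxH, hmaxX, hdir⟩ := exists_top_corner hω (by omega)
  rcases hdir with ⟨hp, hs⟩ | ⟨hs', hp'⟩
  · -- FORWARD orientation: `ω (i₀-1) = (xm-1,H)`, `ω (i₀+1) = (xm,H-1)`
    have hpar : (xm + H) % 2 = 1 := by
      have hvc := vertical_cases (hbw i₀ (by omega)) (by rw [hv, hs]; simp)
      rw [hv, hs] at hvc; simp only [pt_apply_zero, pt_apply_one] at hvc; omega
    obtain ⟨hi₀2, h2⟩ := top_corner_pred hω hi₀ hi₀n hv hmaxH hp hs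
    by_cases hA : ∃ t, t ≤ n ∧ ω t = pt (xm - 3) H
    · -- case A
      obtain ⟨t, ht, hωt⟩ := hA
      obtain ⟨hi₀3, h3⟩ := caseA_fwd hE hpar hH1 hmaxH hi₀2 hi₀n h2 hp ht hωt
      have hx3 : 3 ≤ xm := by have := hcol t; rw [hωt] at this; simp only [pt_apply_zero] at this; omega
      refine ⟨2, i₀ - 3, offA, xm, H, true, spliceOK_A hpar hx3 (by omega) hmaxH hmaxX ?_ (by omega)⟩
      intro s hsL
      interval_cases s
      · exact tpath_eq (by rw [show i₀ - 3 + 0 = i₀ - 3 by omega, h3]) (by simp [rd, w6A])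
      · exact tpath_eq (by rw [show i₀ - 3 + 1 = i₀ - 2 by omega, h2]) (by simp [rd, w6A])
      · exact tpath_eq (by rw [show i₀ - 3 + 2 = i₀ - 1 by omega, hp]) (by simp [rd, w6A])
    · push Not at hA
      by_cases hx3 : 3 ≤ xm
      · -- case B
        refine ⟨2, i₀ - 2, offB, xm, H, true, spliceOK_B hpar hx3 (by omega) hmaxH hmaxX (fun i hi => hA i hi) ?_ (by omega)⟩
        intro s hsL
        interval_cases s
        · exact tpath_eq (by rw [show i₀ - 2 + 0 = i₀ - 2 by omega, h2]) (by simp [rd, w6B])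
        · exact tpath_eq (by rw [show i₀ - 2 + 1 = i₀ - 1 by omega, hp]) (by simp [rd, w6B])
        · exact tpath_eq (by rw [show i₀ - 2 + 2 = i₀ by omega, hv]) (by simp [rd, w6B])
      · -- case C: `xm = 2`
        have hx2 : xm = 2 := by have := hcol (i₀ - 2); rw [h2] at this; simp only [pt_apply_zero] at this; omega
        subst hx2
        obtain ⟨hi₀2', hstep⟩ := caseC_fwd_step hE hpar rfl hi₀ hi₀n hv hs
        rcases hstep with hC0 | hC
        · -- case C0: the hexagon
          obtain ⟨hi3, hHeq, hn5⟩ := caseC0_fwd hω (by omega) hpar rfl hH1 hi₀2 hi₀2' h2 hp hs hC0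
          subst hHeq; subst hi3
          have hω2 : ω 2 = pt 1 1 := by have h := hp; norm_num at h; exact h
          have hω4 : ω 4 = pt 2 0 := by have h := hs; norm_num at h; exact h
          have hω5 : ω 5 = pt 1 0 := by have h := hC0; norm_num at h; exact h
          have hfree := caseC0_free hω hn5 (by rw [h0]; funext l; fin_cases l <;> rfl)
            (by rw [s6_site_eq_iff]; simp [h1.1, h1.2]) hω2 hv hω4 hω5
          refine ⟨2, 2, offC0, 2, 1, true, spliceOK_C0 hpar rfl hmaxH hmaxX hfree ?_ (by omega)⟩
          intro s hsL
          interval_cases s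
          · exact tpath_eq hω2 (by simp [rd, w6C0])
          · exact tpath_eq hv (by simp [rd, w6C0])
          · exact tpath_eq hω4 (by simp [rd, w6C0])
        · by_cases hC2 : ∃ t, t ≤ n ∧ ω t = pt 4 (H - 1)
          · -- case C2
            obtain ⟨t, ht, hωt⟩ := hC2
            obtain ⟨hi₀3, h3⟩ := caseC2_fwd hE hpar rfl hH1 hmaxH hmaxX hi₀2' hs hC ht hωt
            refine ⟨4, i₀ - 1, offC2, 2, H, true, spliceOK_C2 hpar rfl hH1 hmaxH hmaxX ?_ (by omega)⟩
            intro s hsL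
            interval_cases s
            · exact tpath_eq (by rw [show i₀ - 1 + 0 = i₀ - 1 by omega, hp]) (by simp [rd, w6C2])
            · exact tpath_eq (by rw [show i₀ - 1 + 1 = i₀ by omega, hv]) (by simp [rd, w6C2])
            · exact tpath_eq (by rw [show i₀ - 1 + 2 = i₀ + 1 by omega, hs]) (by simp [rd, w6C2])
            · exact tpath_eq (by rw [show i₀ - 1 + 3 = i₀ + 2 by omega, hC]) (by simp [rd, w6C2])
            · exact tpath_eq (by rw [show i₀ - 1 + 4 = i₀ + 3 by omega, h3]) (by simp [rd, w6C2])
          · -- case C1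
            push Not at hC2
            refine ⟨2, i₀, offC1, 2, H, true, spliceOK_C1 hpar rfl hmaxH hmaxX (fun i hi => hC2 i hi) ?_ (by omega)⟩
            intro s hsL
            interval_cases s
            · exact tpath_eq (by rw [add_zero, hv]) (by simp [rd, w6C1])
            · exact tpath_eq hs (by simp [rd, w6C1])
            · exact tpath_eq hC (by simp [rd, w6C1])
  · -- BACKWARD orientation: `ω (i₀+1) = (xm-1,H)`, `ω (i₀-1) = (xm,H-1)`
    have hpar : (xm + H) % 2 = 1 := by
      have hvc := vertical_cases (hbw (i₀ - 1) (by omega)) (by rw [show i₀ - 1 + 1 = i₀ by omega, hv, hp']; simp)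
      rw [show i₀ - 1 + 1 = i₀ by omega, hv, hp'] at hvc; simp only [pt_apply_zero, pt_apply_one] at hvc; omega
    obtain ⟨hi₀2, h2⟩ := top_corner_succ hω hi₀ hi₀n hv hmaxH hs' hp'
    by_cases hA : ∃ t, t ≤ n ∧ ω t = pt (xm - 3) H
    · -- case A (backward)
      obtain ⟨t, ht, hωt⟩ := hA
      obtain ⟨hi₀3, h3⟩ := caseA_bwd hE hpar hH1 hmaxH hi₀2 h2 hs' ht hωt
      have hx3 : 3 ≤ xm := by have := hcol t; rw [hωt] at this; simp only [pt_apply_zero] at this; omega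
      refine ⟨2, i₀ + 1, offA, xm, H, false, spliceOK_A hpar hx3 (by omega) hmaxH hmaxX ?_ (by omega)⟩
      intro s hsL
      interval_cases s
      · exact tpath_eq (by rw [add_zero, hs']) (by simp [rd, w6A])
      · exact tpath_eq (by rw [show i₀ + 1 + 1 = i₀ + 2 by omega, h2]) (by simp [rd, w6A])
      · exact tpath_eq (by rw [show i₀ + 1 + 2 = i₀ + 3 by omega, h3]) (by simp [rd, w6A])
    · push Not at hA
      by_cases hx3 : 3 ≤ xm
      · -- case B (backward)
        refine ⟨2, i₀, offB, xm, H, false, spliceOK_B hpar hx3 (by omega) hmaxH hmaxX (fun i hi => hA i hi) ?_ (by omega)⟩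
        intro s hsL
        interval_cases s
        · exact tpath_eq (by rw [add_zero, hv]) (by simp [rd, w6B])
        · exact tpath_eq hs' (by simp [rd, w6B])
        · exact tpath_eq h2 (by simp [rd, w6B])
      · have hx2 : xm = 2 := by have := hcol (i₀ + 2); rw [h2] at this; simp only [pt_apply_zero] at this; omega
        subst hx2
        obtain ⟨hi₀2', hstep⟩ := caseC_bwd_step hE hpar rfl hi₀ hi₀n hv hp'
        rcases hstep with hC0 | hC
        · exact (caseC0_bwd_false hω hpar rfl hH1 hi₀2' hi₀2 h2 hs' hC0).elim
        · by_cases hC2 : ∃ t, t ≤ n ∧ ω t = pt 4 (H - 1)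
          · -- case C2 (backward)
            obtain ⟨t, ht, hωt⟩ := hC2
            obtain ⟨hi₀3, h3⟩ := caseC2_bwd hE hpar rfl hmaxX hi₀2' (by omega) hp' hC ht hωt
            refine ⟨4, i₀ - 3, offC2, 2, H, false, spliceOK_C2 hpar rfl hH1 hmaxH hmaxX ?_ (by omega)⟩
            intro s hsL
            interval_cases s
            · exact tpath_eq (by rw [show i₀ - 3 + 0 = i₀ - 3 by omega, h3]) (by simp [rd, w6C2])
            · exact tpath_eq (by rw [show i₀ - 3 + 1 = i₀ - 2 by omega, hC]) (by simp [rd, w6C2])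
            · exact tpath_eq (by rw [show i₀ - 3 + 2 = i₀ - 1 by omega, hp']) (by simp [rd, w6C2])
            · exact tpath_eq (by rw [show i₀ - 3 + 3 = i₀ by omega, hv]) (by simp [rd, w6C2])
            · exact tpath_eq (by rw [show i₀ - 3 + 4 = i₀ + 1 by omega, hs']) (by simp [rd, w6C2])
          · -- case C1 (backward)
            push Not at hC2
            refine ⟨2, i₀ - 2, offC1, 2, H, false, spliceOK_C1 hpar rfl hmaxH hmaxX (fun i hi => hC2 i hi) ?_ (by omega)⟩
            intro s hsL
            interval_cases s
            · exact tpath_eq (by rw [show i₀ - 2 + 0 = i₀ - 2 by omega, hC]) (by simp [rd, w6C1])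
            · exact tpath_eq (by rw [show i₀ - 2 + 1 = i₀ - 1 by omega, hp']) (by simp [rd, w6C1])
            · exact tpath_eq (by rw [show i₀ - 2 + 2 = i₀ by omega, hv]) (by simp [rd, w6C1])

/-- **Existence half, stated on its own**: every canonical rooted polygon `ω ∈ canonEnd n`, `n ≥ 5`, admits an admissible `+6`
surgery, so `canonEnd (n + 6)` is nonempty (the injective map is `stepSix`, its injectivity `SixSpec.inj`, the count
`card_canonEnd_le_add_six` below). [cite: MadrasSlade1993, Theorem 3.2.3 (3.2.3) p. 64 (ℤ^d: q_N ≤ q_{N+2})] -/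
theorem exists_mem_canonEnd_add_six (hω : ω ∈ canonEnd n) (hn : 5 ≤ n) : ∃ W, W ∈ canonEnd (n + 6) := by
  obtain ⟨L, j, off, xm, H, fwd, hOK⟩ := stepSix_exists hω hn
  exact ⟨_, splice6_mem_canonEnd hω hOK⟩

end Assembly

/-! ### Decoding, I: sites of the spliced walk; the intrinsic top corner -/

section DecodeBasics

variable {L j : ℕ} {π : ℕ → Site 2}

/-- **Every site of the spliced walk is a site of `ω` outside the open window or a site of the new path.**
[cite: MadrasSlade1993, §3.2 (proof of Theorem 3.2.3: reconstruction)] -/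
theorem splice6_site_cases (hP : Splice6OK n L ω j π) {i : ℕ} (hi : i ≤ n + 6) :
    (∃ a, a ≤ n ∧ (a ≤ j ∨ j + L ≤ a) ∧ splice6 L ω π j i = ω a) ∨ (∃ s, s ≤ L + 6 ∧ splice6 L ω π j i = π s) := by
  have hwnd := hP.wnd
  rcases le_or_gt i j with h1 | h1
  · exact Or.inl ⟨i, by omega, Or.inl h1, splice6_of_le h1⟩
  rcases Nat.lt_or_ge i (j + L + 6) with h2 | h2
  · obtain ⟨s, rfl⟩ : ∃ s, i = j + s := ⟨i - j, by omega⟩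
    exact Or.inr ⟨s, by omega, splice6_mid hP.start (by omega)⟩
  · exact Or.inl ⟨i - 6, by omega, Or.inr (by omega), splice6_of_ge hP.finish h2⟩

/-- A site of `ω` before the window is a site of the spliced walk. [cite: MadrasSlade1993, §3.2] -/
theorem splice6_has_left (hP : Splice6OK n L ω j π) {a : ℕ} (ha : a ≤ j) : ∃ i, i ≤ n + 6 ∧ splice6 L ω π j i = ω a :=
  ⟨a, by have := hP.wnd; omega, splice6_of_le ha⟩

/-- A site of `ω` after the window is a site of the spliced walk. [cite: MadrasSlade1993, §3.2] -/
theorem splice6_has_right (hP : Splice6OK n L ω j π) {a : ℕ} (ha : j + L ≤ a) (han : a ≤ n) :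
    ∃ i, i ≤ n + 6 ∧ splice6 L ω π j i = ω a :=
  ⟨a + 6, by omega, by rw [splice6_of_ge hP.finish (by omega)]; congr 1⟩

/-- A site of the new path is a site of the spliced walk. [cite: MadrasSlade1993, §3.2] -/
theorem splice6_has_mid (hP : Splice6OK n L ω j π) {s : ℕ} (hs : s ≤ L + 6) :
    ∃ i, i ≤ n + 6 ∧ splice6 L ω π j i = π s :=
  ⟨j + s, by have := hP.wnd; omega, splice6_mid hP.start hs⟩

/-- **Intrinsic top corner of a walk**: `H'` bounds all heights, `x'` bounds the abscissae on the top row, and the site `(x', H')` is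
visited at time `τ`. [cite: MadrasSlade1993, §3.2 (proof of Theorem 3.2.3: the lexicographically largest point)] -/
def TopSix (N : ℕ) (W : ℕ → Site 2) (H' x' : ℤ) (τ : ℕ) : Prop :=
  (∀ i, i ≤ N → W i 1 ≤ H') ∧ (∀ i, i ≤ N → W i 1 = H' → W i 0 ≤ x') ∧ τ ≤ N ∧ W τ = pt x' H'

/-- The intrinsic top corner is unique (given injectivity of the walk). [cite: MadrasSlade1993, §3.2 (proof of Theorem 3.2.3)] -/
theorem topAt_unique {N : ℕ} {W : ℕ → Site 2} (hinj : Set.InjOn W {i | i ≤ N}) {H₁ x₁ H₂ x₂ : ℤ} {τ₁ τ₂ : ℕ}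
    (h₁ : TopSix N W H₁ x₁ τ₁) (h₂ : TopSix N W H₂ x₂ τ₂) : H₁ = H₂ ∧ x₁ = x₂ ∧ τ₁ = τ₂ := by
  obtain ⟨hH₁, hx₁, hτ₁, hW₁⟩ := h₁
  obtain ⟨hH₂, hx₂, hτ₂, hW₂⟩ := h₂
  have e1 := hH₂ τ₁ hτ₁; rw [hW₁] at e1; simp only [pt_apply_one] at e1
  have e2 := hH₁ τ₂ hτ₂; rw [hW₂] at e2; simp only [pt_apply_one] at e2
  have hH : H₁ = H₂ := le_antisymm e1 e2
  have e3 := hx₂ τ₁ hτ₁ (by rw [hW₁]; simp [hH]); rw [hW₁] at e3; simp only [pt_apply_zero] at e3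
  have e4 := hx₁ τ₂ hτ₂ (by rw [hW₂]; simp [hH]); rw [hW₂] at e4; simp only [pt_apply_zero] at e4
  have hx : x₁ = x₂ := le_antisymm e3 e4
  refine ⟨hH, hx, ?_⟩
  apply hinj (show τ₁ ∈ {i | i ≤ N} by simpa using hτ₁) (show τ₂ ∈ {i | i ≤ N} by simpa using hτ₂)
  rw [hW₁, hW₂, hH, hx]

end DecodeBasics

/-! ### Decoding, II: generic image facts for a table surgery -/

section DecodeGeneric

variable {L j : ℕ} {off w : ℕ → ℤ × ℤ} {xm H : ℤ} {fwd : Bool}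

/-- **The intrinsic top corner of the image**, from the table: if every entry has height offset `≤ dH` (`dH ≥ 1`), every entry of height
offset `dH` has abscissa offset `≤ dX`, and entry `u₀` is `(dX, dH)`, then the image's top corner is `(xm + dX, H + dH)`, visited at time
`j + s₀` with `rd fwd (L+6) s₀ = u₀`. [cite: MadrasSlade1993, §3.2 (proof of Theorem 3.2.3: reconstruction)] -/
theorem topAt_splice (hmaxH : ∀ i, i ≤ n → ω i 1 ≤ H) (hP : Splice6OK n L ω j (tpath off (L + 6) xm H fwd))
    {dH dX : ℤ} (hdH : 1 ≤ dH) (htab : ∀ u, u ≤ L + 6 → (off u).2 ≤ dH ∧ ((off u).2 = dH → (off u).1 ≤ dX))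
    {u₀ : ℕ} (hu₀ : u₀ ≤ L + 6) (hoff : off u₀ = (dX, dH)) :
    TopSix (n + 6) (splice6 L ω (tpath off (L + 6) xm H fwd) j) (H + dH) (xm + dX) (j + rd fwd (L + 6) u₀) := by
  refine ⟨fun i hi => ?_, fun i hi hiH => ?_, by have := hP.wnd; have := rd_le (fwd := fwd) hu₀; omega, ?_⟩
  · rcases splice6_site_cases hP hi with ⟨a, ha, -, hia⟩ | ⟨s, hs, his⟩
    · rw [hia]; have := hmaxH a ha; omega
    · rw [his, tpath, pt_apply_one]; have := (htab _ (rd_le (fwd := fwd) hs)).1; omega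
  · rcases splice6_site_cases hP hi with ⟨a, ha, -, hia⟩ | ⟨s, hs, his⟩
    · rw [hia] at hiH ⊢; have := hmaxH a ha; omega
    · rw [his, tpath, pt_apply_one] at hiH; rw [his, tpath, pt_apply_zero]
      have := (htab _ (rd_le (fwd := fwd) hs)).2 (by omega); omega
  · rw [splice6_mid hP.start (rd_le hu₀), tpath]
    have : rd fwd (L + 6) (rd fwd (L + 6) u₀) = u₀ := by unfold rd; split_ifs <;> omega
    rw [this, hoff]

/-- **A site of the new path is a site of the image** (table entry `u`). [cite: MadrasSlade1993, §3.2] -/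
theorem splice_has_of_table (hP : Splice6OK n L ω j (tpath off (L + 6) xm H fwd)) {u : ℕ} (hu : u ≤ L + 6) {dx dy : ℤ}
    (hoff : off u = (dx, dy)) : ∃ i, i ≤ n + 6 ∧ splice6 L ω (tpath off (L + 6) xm H fwd) j i = pt (xm + dx) (H + dy) := by
  obtain ⟨i, hi, h⟩ := splice6_has_mid hP (rd_le (fwd := fwd) hu)
  refine ⟨i, hi, ?_⟩
  rw [h, tpath]
  have : rd fwd (L + 6) (rd fwd (L + 6) u) = u := by unfold rd; split_ifs <;> omega
  rw [this, hoff]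

/-- **A site avoided by `ω` (outside the open window) and by the table is not a site of the image.** [cite: MadrasSlade1993, §3.2] -/
theorem splice_not_of_table (hP : Splice6OK n L ω j (tpath off (L + 6) xm H fwd)) {dx dy : ℤ}
    (hωno : ∀ a, a ≤ n → (a ≤ j ∨ j + L ≤ a) → ω a ≠ pt (xm + dx) (H + dy))
    (htab : ∀ u, u ≤ L + 6 → off u ≠ (dx, dy)) :
    ∀ i, i ≤ n + 6 → splice6 L ω (tpath off (L + 6) xm H fwd) j i ≠ pt (xm + dx) (H + dy) := by
  intro i hi h
  rcases splice6_site_cases hP hi with ⟨a, ha, hao, hia⟩ | ⟨s, hs, his⟩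
  · exact hωno a ha hao (hia ▸ h)
  · rw [his, tpath] at h
    obtain ⟨h1, h2⟩ := pt_inj.1 h
    exact htab _ (rd_le hs) (Prod.ext (by simpa using h1) (by simpa using h2))

/-- The predecessor (in time) of the image's top corner. [cite: MadrasSlade1993, §3.2 (proof of Theorem 3.2.3: orientation)] -/
theorem splice_pred_top (hP : Splice6OK n L ω j (tpath off (L + 6) xm H fwd)) {u₀ : ℕ} (hu₀0 : 1 ≤ u₀) (hu₀ : u₀ + 1 ≤ L + 6) :
    splice6 L ω (tpath off (L + 6) xm H fwd) j (j + rd fwd (L + 6) u₀ - 1) =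
      pt (xm + (off (if fwd then u₀ - 1 else u₀ + 1)).1) (H + (off (if fwd then u₀ - 1 else u₀ + 1)).2) := by
  have hr : 1 ≤ rd fwd (L + 6) u₀ := by unfold rd; split_ifs <;> omega
  rw [show j + rd fwd (L + 6) u₀ - 1 = j + (rd fwd (L + 6) u₀ - 1) by omega,
    splice6_mid hP.start (by have := rd_le (fwd := fwd) (show u₀ ≤ L + 6 by omega); omega), tpath]
  have : rd fwd (L + 6) (rd fwd (L + 6) u₀ - 1) = (if fwd then u₀ - 1 else u₀ + 1) := by
    cases fwd
    · simp only [rd, Bool.false_eq_true, ↓reduceIte]; omega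
    · simp only [rd, ↓reduceIte]
  rw [this]

/-- **Reading off the original**: two surgeries with the same window position `j`, length `L`, window table, replacement table, base
and direction whose images agree come from the same polygon. [cite: MadrasSlade1993, §3.2 (proof of Theorem 3.2.3: reconstruction of `P`)] -/
theorem eq_of_splice6_eq {ω' : ℕ → Site 2} (hω : ω ∈ endAt n (Pi.single 0 1 : Site 2)) (hω' : ω' ∈ endAt n (Pi.single 0 1 : Site 2))
    (hP : Splice6OK n L ω j (tpath off (L + 6) xm H fwd)) (hP' : Splice6OK n L ω' j (tpath off (L + 6) xm H fwd))
    (hw : ∀ s, s ≤ L → ω (j + s) = tpath w L xm H fwd s) (hw' : ∀ s, s ≤ L → ω' (j + s) = tpath w L xm H fwd s)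
    (h : splice6 L ω (tpath off (L + 6) xm H fwd) j = splice6 L ω' (tpath off (L + 6) xm H fwd) j) : ω = ω' := by
  have hwnd := hP.wnd
  have h1 : ∀ i, i ≤ n → ω i = ω' i := by
    intro i hi
    rcases le_or_gt i j with hij | hij
    · have := congrFun h i; rwa [splice6_of_le hij, splice6_of_le hij] at this
    rcases Nat.lt_or_ge i (j + L) with h2 | h2
    · obtain ⟨s, rfl⟩ : ∃ s, i = j + s := ⟨i - j, by omega⟩
      rw [hw s (by omega), hw' s (by omega)]
    · have := congrFun h (i + 6)
      rwa [splice6_of_ge hP.finish (by omega), splice6_of_ge hP'.finish (by omega), show i + 6 - 6 = i by omega] at this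
  funext i
  rcases le_or_gt i n with hi | hi
  · exact h1 i hi
  · rw [(mem_endAt_iff.1 hω).1.2.1 i hi.le, (mem_endAt_iff.1 hω').1.2.1 i hi.le]; exact h1 n le_rfl

end DecodeGeneric

/-! ### The surgery data of a canonical polygon -/

section Spec

/-- The five cases of the door note. [cite: MadrasSlade1993, §3.2 (proof of Theorem 3.2.3)] -/
inductive SixKind | A | B | C1 | C2 | C0
  deriving DecidableEq

/-- Window length of a case. [cite: MadrasSlade1993, §3.2] -/
def SixKind.L : SixKind → ℕ | .A => 2 | .B => 2 | .C1 => 2 | .C2 => 4 | .C0 => 2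
/-- Replacement table of a case. [cite: MadrasSlade1993, §3.2] -/
def SixKind.off : SixKind → ℕ → ℤ × ℤ | .A => offA | .B => offB | .C1 => offC1 | .C2 => offC2 | .C0 => offC0
/-- Window table of a case. [cite: MadrasSlade1993, §3.2] -/
def SixKind.w : SixKind → ℕ → ℤ × ℤ | .A => w6A | .B => w6B | .C1 => w6C1 | .C2 => w6C2 | .C0 => w6C0
/-- Height gain of the image's top corner. [cite: MadrasSlade1993, §3.2] -/
def SixKind.dH : SixKind → ℤ | .A => 2 | .B => 1 | .C1 => 1 | .C2 => 2 | .C0 => 1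
/-- Abscissa shift of the image's top corner. [cite: MadrasSlade1993, §3.2] -/
def SixKind.dX : SixKind → ℤ | .A => 0 | .B => 1 | .C1 => 3 | .C2 => 0 | .C0 => 1
/-- Table index of the image's top corner. [cite: MadrasSlade1993, §3.2] -/
def SixKind.u₀ : SixKind → ℕ | .A => 5 | .B => 6 | .C1 => 4 | .C2 => 5 | .C0 => 3

/-- **Surgery data** of a canonical polygon `ω ∈ canonEnd n`: the case, the window position, the top corner `(xm, H)` of `ω` with its
extremal properties, the direction, the window identity and the admissibility of the surgery, plus the two case-specific facts used in
decoding. [cite: MadrasSlade1993, §3.2 (proof of Theorem 3.2.3)] -/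
structure SixSpec (n : ℕ) (ω : ℕ → Site 2) where
  /-- the case -/
  κ : SixKind
  /-- window start time -/
  j : ℕ
  /-- top corner abscissa -/
  xm : ℤ
  /-- top corner height -/
  H : ℤ
  /-- direction of traversal at the top corner -/
  fwd : Bool
  maxH : ∀ i, i ≤ n → ω i 1 ≤ H
  maxX : ∀ i, i ≤ n → ω i 1 = H → ω i 0 ≤ xm
  hw : ∀ s, s ≤ κ.L → ω (j + s) = tpath κ.w κ.L xm H fwd s
  ok : Splice6OK n κ.L ω j (tpath κ.off (κ.L + 6) xm H fwd)
  factC1 : κ = .C1 → xm = 2 ∧ ∃ a, a ≤ n ∧ (a ≤ j ∨ j + κ.L ≤ a) ∧ ω a = pt 1 H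
  factC0 : κ = .C0 → xm = 2 ∧ H = 1 ∧ ∀ i, i ≤ n → ω i ≠ pt 5 0
  factC2 : κ = .C2 → xm = 2

/-- The image of the surgery. [cite: MadrasSlade1993, §3.2 (proof of Theorem 3.2.3)] -/
def SixSpec.image {n : ℕ} {ω : ℕ → Site 2} (d : SixSpec n ω) : ℕ → Site 2 :=
  splice6 d.κ.L ω (tpath d.κ.off (d.κ.L + 6) d.xm d.H d.fwd) d.j

/-- **Every canonical rooted polygon with `n ≥ 5` has surgery data.** [cite: MadrasSlade1993, §3.2 (proof of Theorem 3.2.3)] -/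
theorem sixSpec_nonempty (hω : ω ∈ canonEnd n) (hn : 5 ≤ n) : Nonempty (SixSpec n ω) := by
  obtain ⟨hE, hlex⟩ := mem_canonEnd.1 hω
  obtain ⟨⟨h0, -, hbw, hinj⟩, hn'⟩ := mem_endAt_iff.1 hE
  have hcol := col_nonneg_of_mem_canonEnd hω
  have h1 := apply_one_of_mem_canonEnd hω (by omega)
  obtain ⟨H, xm, i₀, hi₀, hi₀n, hv, hH1, hmaxH, hmaxX, hdir⟩ := exists_top_corner hω (by omega)
  rcases hdir with ⟨hp, hs⟩ | ⟨hs', hp'⟩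
  · -- FORWARD orientation
    have hpar : (xm + H) % 2 = 1 := by
      have hvc := vertical_cases (hbw i₀ (by omega)) (by rw [hv, hs]; simp)
      rw [hv, hs] at hvc; simp only [pt_apply_zero, pt_apply_one] at hvc; omega
    obtain ⟨hi₀2, h2⟩ := top_corner_pred hω hi₀ hi₀n hv hmaxH hp hs
    by_cases hA : ∃ t, t ≤ n ∧ ω t = pt (xm - 3) H
    · obtain ⟨t, ht, hωt⟩ := hA
      obtain ⟨hi₀3, h3⟩ := caseA_fwd hE hpar hH1 hmaxH hi₀2 hi₀n h2 hp ht hωt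
      have hx3 : 3 ≤ xm := by have := hcol t; rw [hωt] at this; simp only [pt_apply_zero] at this; omega
      have hw : ∀ s, s ≤ 2 → ω (i₀ - 3 + s) = tpath w6A 2 xm H true s := by
        intro s hsL
        interval_cases s
        · exact tpath_eq (by rw [show i₀ - 3 + 0 = i₀ - 3 by omega, h3]) (by simp [rd, w6A])
        · exact tpath_eq (by rw [show i₀ - 3 + 1 = i₀ - 2 by omega, h2]) (by simp [rd, w6A])
        · exact tpath_eq (by rw [show i₀ - 3 + 2 = i₀ - 1 by omega, hp]) (by simp [rd, w6A])
      exact ⟨⟨.A, i₀ - 3, xm, H, true, hmaxH, hmaxX, hw, spliceOK_A hpar hx3 (by omega) hmaxH hmaxX hw (by omega),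
        fun h => SixKind.noConfusion h, fun h => SixKind.noConfusion h, fun h => SixKind.noConfusion h⟩⟩
    · push Not at hA
      by_cases hx3 : 3 ≤ xm
      · have hw : ∀ s, s ≤ 2 → ω (i₀ - 2 + s) = tpath w6B 2 xm H true s := by
          intro s hsL
          interval_cases s
          · exact tpath_eq (by rw [show i₀ - 2 + 0 = i₀ - 2 by omega, h2]) (by simp [rd, w6B])
          · exact tpath_eq (by rw [show i₀ - 2 + 1 = i₀ - 1 by omega, hp]) (by simp [rd, w6B])
          · exact tpath_eq (by rw [show i₀ - 2 + 2 = i₀ by omega, hv]) (by simp [rd, w6B])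
        exact ⟨⟨.B, i₀ - 2, xm, H, true, hmaxH, hmaxX, hw, spliceOK_B hpar hx3 (by omega) hmaxH hmaxX (fun i hi => hA i hi) hw (by omega),
          fun h => SixKind.noConfusion h, fun h => SixKind.noConfusion h, fun h => SixKind.noConfusion h⟩⟩
      · have hx2 : xm = 2 := by have := hcol (i₀ - 2); rw [h2] at this; simp only [pt_apply_zero] at this; omega
        subst hx2
        obtain ⟨hi₀2', hstep⟩ := caseC_fwd_step hE hpar rfl hi₀ hi₀n hv hs
        rcases hstep with hC0 | hC
        · obtain ⟨hi3, hHeq, hn5⟩ := caseC0_fwd hω (by omega) hpar rfl hH1 hi₀2 hi₀2' h2 hp hs hC0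
          subst hHeq; subst hi3
          have hω2 : ω 2 = pt 1 1 := by have h := hp; norm_num at h; exact h
          have hω4 : ω 4 = pt 2 0 := by have h := hs; norm_num at h; exact h
          have hω5 : ω 5 = pt 1 0 := by have h := hC0; norm_num at h; exact h
          have hω0 : ω 0 = pt 0 0 := by rw [h0]; funext l; fin_cases l <;> rfl
          have hω1 : ω 1 = pt 0 1 := by rw [s6_site_eq_iff]; simp [h1.1, h1.2]
          have hfree := caseC0_free hω hn5 hω0 hω1 hω2 hv hω4 hω5
          have hw : ∀ s, s ≤ 2 → ω (2 + s) = tpath w6C0 2 2 1 true s := by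
            intro s hsL
            interval_cases s
            · exact tpath_eq hω2 (by simp [rd, w6C0])
            · exact tpath_eq hv (by simp [rd, w6C0])
            · exact tpath_eq hω4 (by simp [rd, w6C0])
          have hno5 : ∀ i, i ≤ n → ω i ≠ pt 5 0 := by
            intro i hi; subst hn5
            interval_cases i <;> simp only [hω0, hω1, hω2, hv, hω4, hω5] <;> exact fun h => by have := (pt_inj.1 h).1; omega
          exact ⟨⟨.C0, 2, 2, 1, true, hmaxH, hmaxX, hw, spliceOK_C0 hpar rfl hmaxH hmaxX hfree hw (by omega),
            fun h => SixKind.noConfusion h, fun _ => ⟨rfl, rfl, hno5⟩, fun h => SixKind.noConfusion h⟩⟩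
        · by_cases hC2 : ∃ t, t ≤ n ∧ ω t = pt 4 (H - 1)
          · obtain ⟨t, ht, hωt⟩ := hC2
            obtain ⟨hi₀3, h3⟩ := caseC2_fwd hE hpar rfl hH1 hmaxH hmaxX hi₀2' hs hC ht hωt
            have hw : ∀ s, s ≤ 4 → ω (i₀ - 1 + s) = tpath w6C2 4 2 H true s := by
              intro s hsL
              interval_cases s
              · exact tpath_eq (by rw [show i₀ - 1 + 0 = i₀ - 1 by omega, hp]) (by simp [rd, w6C2])
              · exact tpath_eq (by rw [show i₀ - 1 + 1 = i₀ by omega, hv]) (by simp [rd, w6C2])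
              · exact tpath_eq (by rw [show i₀ - 1 + 2 = i₀ + 1 by omega, hs]) (by simp [rd, w6C2])
              · exact tpath_eq (by rw [show i₀ - 1 + 3 = i₀ + 2 by omega, hC]) (by simp [rd, w6C2])
              · exact tpath_eq (by rw [show i₀ - 1 + 4 = i₀ + 3 by omega, h3]) (by simp [rd, w6C2])
            exact ⟨⟨.C2, i₀ - 1, 2, H, true, hmaxH, hmaxX, hw, spliceOK_C2 hpar rfl hH1 hmaxH hmaxX hw (by omega),
              fun h => SixKind.noConfusion h, fun h => SixKind.noConfusion h, fun _ => rfl⟩⟩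
          · push Not at hC2
            have hw : ∀ s, s ≤ 2 → ω (i₀ + s) = tpath w6C1 2 2 H true s := by
              intro s hsL
              interval_cases s
              · exact tpath_eq (by rw [add_zero, hv]) (by simp [rd, w6C1])
              · exact tpath_eq hs (by simp [rd, w6C1])
              · exact tpath_eq hC (by simp [rd, w6C1])
            exact ⟨⟨.C1, i₀, 2, H, true, hmaxH, hmaxX, hw, spliceOK_C1 hpar rfl hmaxH hmaxX (fun i hi => hC2 i hi) hw (by omega),
              fun _ => ⟨rfl, i₀ - 1, by omega, Or.inl (by omega), by rw [hp]; norm_num⟩,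
              fun h => SixKind.noConfusion h, fun h => SixKind.noConfusion h⟩⟩
  · -- BACKWARD orientation
    have hpar : (xm + H) % 2 = 1 := by
      have hvc := vertical_cases (hbw (i₀ - 1) (by omega)) (by rw [show i₀ - 1 + 1 = i₀ by omega, hv, hp']; simp)
      rw [show i₀ - 1 + 1 = i₀ by omega, hv, hp'] at hvc; simp only [pt_apply_zero, pt_apply_one] at hvc; omega
    obtain ⟨hi₀2, h2⟩ := top_corner_succ hω hi₀ hi₀n hv hmaxH hs' hp'
    by_cases hA : ∃ t, t ≤ n ∧ ω t = pt (xm - 3) H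
    · obtain ⟨t, ht, hωt⟩ := hA
      obtain ⟨hi₀3, h3⟩ := caseA_bwd hE hpar hH1 hmaxH hi₀2 h2 hs' ht hωt
      have hx3 : 3 ≤ xm := by have := hcol t; rw [hωt] at this; simp only [pt_apply_zero] at this; omega
      have hw : ∀ s, s ≤ 2 → ω (i₀ + 1 + s) = tpath w6A 2 xm H false s := by
        intro s hsL
        interval_cases s
        · exact tpath_eq (by rw [add_zero, hs']) (by simp [rd, w6A])
        · exact tpath_eq (by rw [show i₀ + 1 + 1 = i₀ + 2 by omega, h2]) (by simp [rd, w6A])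
        · exact tpath_eq (by rw [show i₀ + 1 + 2 = i₀ + 3 by omega, h3]) (by simp [rd, w6A])
      exact ⟨⟨.A, i₀ + 1, xm, H, false, hmaxH, hmaxX, hw, spliceOK_A hpar hx3 (by omega) hmaxH hmaxX hw (by omega),
        fun h => SixKind.noConfusion h, fun h => SixKind.noConfusion h, fun h => SixKind.noConfusion h⟩⟩
    · push Not at hA
      by_cases hx3 : 3 ≤ xm
      · have hw : ∀ s, s ≤ 2 → ω (i₀ + s) = tpath w6B 2 xm H false s := by
          intro s hsL
          interval_cases s
          · exact tpath_eq (by rw [add_zero, hv]) (by simp [rd, w6B])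
          · exact tpath_eq hs' (by simp [rd, w6B])
          · exact tpath_eq h2 (by simp [rd, w6B])
        exact ⟨⟨.B, i₀, xm, H, false, hmaxH, hmaxX, hw, spliceOK_B hpar hx3 (by omega) hmaxH hmaxX (fun i hi => hA i hi) hw (by omega),
          fun h => SixKind.noConfusion h, fun h => SixKind.noConfusion h, fun h => SixKind.noConfusion h⟩⟩
      · have hx2 : xm = 2 := by have := hcol (i₀ + 2); rw [h2] at this; simp only [pt_apply_zero] at this; omega
        subst hx2
        obtain ⟨hi₀2', hstep⟩ := caseC_bwd_step hE hpar rfl hi₀ hi₀n hv hp'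
        rcases hstep with hC0 | hC
        · exact (caseC0_bwd_false hω hpar rfl hH1 hi₀2' hi₀2 h2 hs' hC0).elim
        · by_cases hC2 : ∃ t, t ≤ n ∧ ω t = pt 4 (H - 1)
          · obtain ⟨t, ht, hωt⟩ := hC2
            obtain ⟨hi₀3, h3⟩ := caseC2_bwd hE hpar rfl hmaxX hi₀2' (by omega) hp' hC ht hωt
            have hw : ∀ s, s ≤ 4 → ω (i₀ - 3 + s) = tpath w6C2 4 2 H false s := by
              intro s hsL
              interval_cases s
              · exact tpath_eq (by rw [show i₀ - 3 + 0 = i₀ - 3 by omega, h3]) (by simp [rd, w6C2])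
              · exact tpath_eq (by rw [show i₀ - 3 + 1 = i₀ - 2 by omega, hC]) (by simp [rd, w6C2])
              · exact tpath_eq (by rw [show i₀ - 3 + 2 = i₀ - 1 by omega, hp']) (by simp [rd, w6C2])
              · exact tpath_eq (by rw [show i₀ - 3 + 3 = i₀ by omega, hv]) (by simp [rd, w6C2])
              · exact tpath_eq (by rw [show i₀ - 3 + 4 = i₀ + 1 by omega, hs']) (by simp [rd, w6C2])
            exact ⟨⟨.C2, i₀ - 3, 2, H, false, hmaxH, hmaxX, hw, spliceOK_C2 hpar rfl hH1 hmaxH hmaxX hw (by omega),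
              fun h => SixKind.noConfusion h, fun h => SixKind.noConfusion h, fun _ => rfl⟩⟩
          · push Not at hC2
            have hw : ∀ s, s ≤ 2 → ω (i₀ - 2 + s) = tpath w6C1 2 2 H false s := by
              intro s hsL
              interval_cases s
              · exact tpath_eq (by rw [show i₀ - 2 + 0 = i₀ - 2 by omega, hC]) (by simp [rd, w6C1])
              · exact tpath_eq (by rw [show i₀ - 2 + 1 = i₀ - 1 by omega, hp']) (by simp [rd, w6C1])
              · exact tpath_eq (by rw [show i₀ - 2 + 2 = i₀ by omega, hv]) (by simp [rd, w6C1])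
            exact ⟨⟨.C1, i₀ - 2, 2, H, false, hmaxH, hmaxX, hw, spliceOK_C1 hpar rfl hmaxH hmaxX (fun i hi => hC2 i hi) hw (by omega),
              fun _ => ⟨rfl, i₀ + 1, by omega, Or.inr (by simp [SixKind.L]; omega), hs'⟩,
              fun h => SixKind.noConfusion h, fun h => SixKind.noConfusion h⟩⟩

end Spec

/-! ### Decoding, III: the image determines the case, the direction and the window -/

section Decode

variable {ω₁ ω₂ : ℕ → Site 2}

/-- Table facts of the five cases (bounded checks). [cite: MadrasSlade1993, §3.2] -/
theorem SixKind.tab (κ : SixKind) :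
    1 ≤ κ.dH ∧ κ.u₀ ≤ κ.L + 6 ∧ 1 ≤ κ.u₀ ∧ κ.u₀ + 1 ≤ κ.L + 6 ∧ κ.off κ.u₀ = (κ.dX, κ.dH) ∧
      κ.off (κ.u₀ - 1) = (κ.dX - 1, κ.dH) ∧ κ.off (κ.u₀ + 1) = (κ.dX, κ.dH - 1) ∧
      (∀ u, u ≤ κ.L + 6 → (κ.off u).2 ≤ κ.dH ∧ ((κ.off u).2 = κ.dH → (κ.off u).1 ≤ κ.dX)) := by
  cases κ <;> decide

/-- The image's intrinsic top corner, for surgery data `d`. [cite: MadrasSlade1993, §3.2 (proof of Theorem 3.2.3)] -/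
theorem SixSpec.topAt {ω : ℕ → Site 2} (d : SixSpec n ω) :
    TopSix (n + 6) d.image (d.H + d.κ.dH) (d.xm + d.κ.dX) (d.j + rd d.fwd (d.κ.L + 6) d.κ.u₀) := by
  obtain ⟨h1, h2, -, -, h5, -, -, h8⟩ := d.κ.tab
  exact topAt_splice d.maxH d.ok h1 h8 h2 h5

/-- The image visits the table site `u`. [cite: MadrasSlade1993, §3.2] -/
theorem SixSpec.has {ω : ℕ → Site 2} (d : SixSpec n ω) {u : ℕ} (hu : u ≤ d.κ.L + 6) {dx dy : ℤ} (hoff : d.κ.off u = (dx, dy)) :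
    ∃ i, i ≤ n + 6 ∧ d.image i = pt (d.xm + dx) (d.H + dy) :=
  splice_has_of_table d.ok hu hoff

/-- The image avoids a site above the top row of `ω` that is not a table site. [cite: MadrasSlade1993, §3.2] -/
theorem SixSpec.not_high {ω : ℕ → Site 2} (d : SixSpec n ω) {dx dy : ℤ} (hdy : 1 ≤ dy)
    (htab : ∀ u, u ≤ d.κ.L + 6 → d.κ.off u ≠ (dx, dy)) : ∀ i, i ≤ n + 6 → d.image i ≠ pt (d.xm + dx) (d.H + dy) :=
  splice_not_of_table d.ok (fun a ha _ h => by have := d.maxH a ha; rw [h] at this; simp at this; omega) htab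

/-- The image avoids a site left of column `0` that is not a table site (canonical `ω`). [cite: MadrasSlade1993, §3.2] -/
theorem SixSpec.not_neg {ω : ℕ → Site 2} (hω : ω ∈ canonEnd n) (d : SixSpec n ω) {dx dy : ℤ} (hdx : d.xm + dx < 0)
    (htab : ∀ u, u ≤ d.κ.L + 6 → d.κ.off u ≠ (dx, dy)) : ∀ i, i ≤ n + 6 → d.image i ≠ pt (d.xm + dx) (d.H + dy) :=
  splice_not_of_table d.ok (fun a _ _ h => by
    have := col_nonneg_of_mem_canonEnd hω a; rw [h] at this; simp at this; omega) htab

/-- **The image determines the original polygon.** [cite: MadrasSlade1993, §3.2 (proof of Theorem 3.2.3: "we can reconstruct `P`")] -/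
theorem SixSpec.inj (hω₁ : ω₁ ∈ canonEnd n) (hω₂ : ω₂ ∈ canonEnd n) (d₁ : SixSpec n ω₁) (d₂ : SixSpec n ω₂)
    (h : d₁.image = d₂.image) : ω₁ = ω₂ := by
  obtain ⟨hE₁, -⟩ := mem_canonEnd.1 hω₁
  obtain ⟨hE₂, -⟩ := mem_canonEnd.1 hω₂
  have hW : d₁.image ∈ endAt (n + 6) (Pi.single 0 1 : Site 2) := splice6_mem hE₁ d₁.ok
  have hinjW := (mem_endAt_iff.1 hW).1.2.2.2
  -- the intrinsic top corner
  have T₁ := d₁.topAt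
  have T₂ := d₂.topAt
  rw [← h] at T₂
  obtain ⟨eH, ex, eτ⟩ := topAt_unique hinjW T₁ T₂
  obtain ⟨t1, t2, t3, t4, t5, t6, t7, t8⟩ := d₁.κ.tab
  obtain ⟨s1, s2, s3, s4, s5, s6, s7, s8⟩ := d₂.κ.tab
  -- the direction: predecessor of the top corner
  have hp₁ := splice_pred_top d₁.ok t3 t4
  have hp₂ := splice_pred_top d₂.ok s3 s4
  have hfwd : d₁.fwd = d₂.fwd := by
    have e : d₁.image (d₁.j + rd d₁.fwd (d₁.κ.L + 6) d₁.κ.u₀ - 1) = d₂.image (d₂.j + rd d₂.fwd (d₂.κ.L + 6) d₂.κ.u₀ - 1) := by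
      rw [h, eτ]
    change splice6 _ _ _ _ _ = splice6 _ _ _ _ _ at e
    rw [hp₁, hp₂] at e
    obtain ⟨e1, e2⟩ := pt_inj.1 e
    by_contra hne
    rcases Bool.eq_false_or_eq_true d₁.fwd with h1 | h1 <;> rcases Bool.eq_false_or_eq_true d₂.fwd with h2 | h2
    · exact hne (h1.trans h2.symm)
    · rw [h1, h2] at e2; simp only [↓reduceIte, Bool.false_eq_true, t6, s7] at e2; omega
    · rw [h1, h2] at e2; simp only [↓reduceIte, Bool.false_eq_true, t7, s6] at e2; omega
    · exact hne (h1.trans h2.symm)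
  -- test sites as explicit statements on the common image
  have hasB : ∀ {ω : ℕ → Site 2} (d : SixSpec n ω), d.κ = .B → ∃ i, i ≤ n + 6 ∧ d.image i = pt (d.xm + d.κ.dX - 3) (d.H + d.κ.dH) := by
    intro ω d hk
    obtain ⟨i, hi, e⟩ := d.has (u := 3) (by rw [hk]; decide) (dx := -2) (dy := 1) (by rw [hk]; rfl)
    exact ⟨i, hi, by rw [e, hk]; simp [SixKind.dX, SixKind.dH]; try ring_nf⟩
  have notP1 : ∀ {ω : ℕ → Site 2} (d : SixSpec n ω), d.κ ≠ .B → ∀ i, i ≤ n + 6 → d.image i ≠ pt (d.xm + d.κ.dX - 3) (d.H + d.κ.dH) := by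
    intro ω d hk i hi
    have := d.not_high (dx := d.κ.dX - 3) (dy := d.κ.dH) (by have := d.κ.tab.1; omega)
      (by revert hk; cases d.κ <;> intro hk <;> first | exact absurd rfl hk | decide) i hi
    rwa [show d.xm + (d.κ.dX - 3) = d.xm + d.κ.dX - 3 by ring] at this
  have hasC1 : ∀ {ω : ℕ → Site 2} (d : SixSpec n ω), d.κ = .C1 →
      ∃ i, i ≤ n + 6 ∧ d.image i = pt (d.xm + d.κ.dX - 4) (d.H + d.κ.dH - 1) := by
    intro ω d hk
    obtain ⟨hx, a, ha, hao, hωa⟩ := d.factC1 hk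
    rcases hao with hao | hao
    · obtain ⟨i, hi, e⟩ := splice6_has_left d.ok hao
      exact ⟨i, hi, by unfold SixSpec.image; rw [e, hωa, hk, hx]; simp [SixKind.dX, SixKind.dH]⟩
    · obtain ⟨i, hi, e⟩ := splice6_has_right d.ok hao ha
      exact ⟨i, hi, by unfold SixSpec.image; rw [e, hωa, hk, hx]; simp [SixKind.dX, SixKind.dH]⟩
  have notP2 : ∀ {ω : ℕ → Site 2}, ω ∈ canonEnd n → ∀ (d : SixSpec n ω), (d.κ = .A ∨ d.κ = .C2 ∨ d.κ = .C0) →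
      ∀ i, i ≤ n + 6 → d.image i ≠ pt (d.xm + d.κ.dX - 4) (d.H + d.κ.dH - 1) := by
    intro ω hω d hk i hi
    rcases hk with hk | hk | hk
    · have := d.not_high (dx := d.κ.dX - 4) (dy := d.κ.dH - 1) (by rw [hk]; decide) (by rw [hk]; decide) i hi
      rwa [show d.xm + (d.κ.dX - 4) = d.xm + d.κ.dX - 4 by ring, show d.H + (d.κ.dH - 1) = d.H + d.κ.dH - 1 by ring] at this
    · have := d.not_high (dx := d.κ.dX - 4) (dy := d.κ.dH - 1) (by rw [hk]; decide) (by rw [hk]; decide) i hi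
      rwa [show d.xm + (d.κ.dX - 4) = d.xm + d.κ.dX - 4 by ring, show d.H + (d.κ.dH - 1) = d.H + d.κ.dH - 1 by ring] at this
    · obtain ⟨hx, -, -⟩ := d.factC0 hk
      have := d.not_neg hω (dx := d.κ.dX - 4) (dy := d.κ.dH - 1) (by rw [hk, hx]; decide) (by rw [hk]; decide) i hi
      rwa [show d.xm + (d.κ.dX - 4) = d.xm + d.κ.dX - 4 by ring, show d.H + (d.κ.dH - 1) = d.H + d.κ.dH - 1 by ring] at this
  have hasP3 : ∀ {ω : ℕ → Site 2} (d : SixSpec n ω), (d.κ = .C2 ∨ d.κ = .C0) →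
      ∃ i, i ≤ n + 6 ∧ d.image i = pt (d.xm + d.κ.dX + 1) (d.H + d.κ.dH - 1) := by
    intro ω d hk
    rcases hk with hk | hk
    · obtain ⟨i, hi, e⟩ := d.has (u := 7) (by rw [hk]; decide) (dx := 1) (dy := 1) (by rw [hk]; rfl)
      exact ⟨i, hi, by rw [e, hk]; simp [SixKind.dX, SixKind.dH]; try ring_nf⟩
    · obtain ⟨i, hi, e⟩ := d.has (u := 5) (by rw [hk]; decide) (dx := 2) (dy := 0) (by rw [hk]; rfl)
      exact ⟨i, hi, by rw [e, hk]; simp [SixKind.dX, SixKind.dH]; try ring_nf⟩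
  have notP3A : ∀ {ω : ℕ → Site 2} (d : SixSpec n ω), d.κ = .A →
      ∀ i, i ≤ n + 6 → d.image i ≠ pt (d.xm + d.κ.dX + 1) (d.H + d.κ.dH - 1) := by
    intro ω d hk i hi
    have := d.not_high (dx := d.κ.dX + 1) (dy := d.κ.dH - 1) (by rw [hk]; decide) (by rw [hk]; decide) i hi
    rwa [show d.xm + (d.κ.dX + 1) = d.xm + d.κ.dX + 1 by ring, show d.H + (d.κ.dH - 1) = d.H + d.κ.dH - 1 by ring] at this
  have hasP4C2 : ∀ {ω : ℕ → Site 2} (d : SixSpec n ω), d.κ = .C2 →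
      ∃ i, i ≤ n + 6 ∧ d.image i = pt (d.xm + d.κ.dX + 2) (d.H + d.κ.dH - 2) := by
    intro ω d hk
    obtain ⟨i, hi, e⟩ := d.has (u := 9) (by rw [hk]; decide) (dx := 2) (dy := 0) (by rw [hk]; rfl)
    exact ⟨i, hi, by rw [e, hk]; simp [SixKind.dX, SixKind.dH]; try ring_nf⟩
  have notP4C0 : ∀ {ω : ℕ → Site 2} (d : SixSpec n ω), d.κ = .C0 →
      ∀ i, i ≤ n + 6 → d.image i ≠ pt (d.xm + d.κ.dX + 2) (d.H + d.κ.dH - 2) := by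
    intro ω d hk i hi
    obtain ⟨hx, hH, hno⟩ := d.factC0 hk
    have := splice_not_of_table d.ok (dx := d.κ.dX + 2) (dy := d.κ.dH - 2)
      (fun a ha _ e => hno a ha (by rw [e, hk, hx, hH]; simp [SixKind.dX, SixKind.dH])) (by rw [hk]; decide) i hi
    unfold SixSpec.image
    rwa [show d.xm + (d.κ.dX + 2) = d.xm + d.κ.dX + 2 by ring, show d.H + (d.κ.dH - 2) = d.H + d.κ.dH - 2 by ring] at this
  -- same case
  have hκ : d₁.κ = d₂.κ := by
    -- transport the test statements of `d₂` to the image of `d₁`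
    have himg : d₂.image = d₁.image := h.symm
    by_contra hne
    -- P1: B versus the rest
    by_cases hB₁ : d₁.κ = .B
    · have hB₂ : d₂.κ ≠ .B := fun h' => hne (hB₁.trans h'.symm)
      obtain ⟨i, hi, e⟩ := hasB d₁ hB₁
      refine notP1 d₂ hB₂ i hi ?_
      rw [himg, e]; congr 1; omega
    by_cases hB₂ : d₂.κ = .B
    · obtain ⟨i, hi, e⟩ := hasB d₂ hB₂
      refine notP1 d₁ hB₁ i hi ?_
      rw [← himg, e]; congr 1 <;> omega
    -- P2: C1 versus {A, C2, C0}
    by_cases hC₁ : d₁.κ = .C1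
    · have h2 : d₂.κ = .A ∨ d₂.κ = .C2 ∨ d₂.κ = .C0 := by
        revert hne hB₂; cases d₂.κ <;> simp [hC₁]
      obtain ⟨i, hi, e⟩ := hasC1 d₁ hC₁
      refine notP2 hω₂ d₂ h2 i hi ?_
      rw [himg, e]; congr 1 <;> omega
    by_cases hC₂ : d₂.κ = .C1
    · have h2 : d₁.κ = .A ∨ d₁.κ = .C2 ∨ d₁.κ = .C0 := by
        revert hne hB₁ hC₁; cases d₁.κ <;> simp
      obtain ⟨i, hi, e⟩ := hasC1 d₂ hC₂
      refine notP2 hω₁ d₁ h2 i hi ?_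
      rw [← himg, e]; congr 1 <;> omega
    -- P3: A versus {C2, C0}
    by_cases hA₁ : d₁.κ = .A
    · have h2 : d₂.κ = .C2 ∨ d₂.κ = .C0 := by
        revert hne hB₂ hC₂; cases d₂.κ <;> simp [hA₁]
      obtain ⟨i, hi, e⟩ := hasP3 d₂ h2
      refine notP3A d₁ hA₁ i hi ?_
      rw [← himg, e]; congr 1 <;> omega
    by_cases hA₂ : d₂.κ = .A
    · have h2 : d₁.κ = .C2 ∨ d₁.κ = .C0 := by
        revert hne hB₁ hC₁ hA₁; cases d₁.κ <;> simp
      obtain ⟨i, hi, e⟩ := hasP3 d₁ h2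
      refine notP3A d₂ hA₂ i hi ?_
      rw [himg, e]; congr 1 <;> omega
    -- P4: C2 versus C0
    have h12 : (d₁.κ = .C2 ∧ d₂.κ = .C0) ∨ (d₁.κ = .C0 ∧ d₂.κ = .C2) := by
      revert hne hB₁ hC₁ hA₁ hB₂ hC₂ hA₂; cases d₁.κ <;> cases d₂.κ <;> simp
    rcases h12 with ⟨h1, h2⟩ | ⟨h1, h2⟩
    · obtain ⟨i, hi, e⟩ := hasP4C2 d₁ h1
      refine notP4C0 d₂ h2 i hi ?_
      rw [himg, e]; congr 1 <;> omega
    · obtain ⟨i, hi, e⟩ := hasP4C2 d₂ h2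
      refine notP4C0 d₁ h1 i hi ?_
      rw [← himg, e]; congr 1 <;> omega
  -- same base, same window position
  have hH : d₁.H = d₂.H := by rw [hκ] at eH; omega
  have hxm : d₁.xm = d₂.xm := by rw [hκ] at ex; omega
  have hj : d₁.j = d₂.j := by rw [hκ, hfwd] at eτ; omega
  -- read off
  have ok₂ := d₂.ok
  have hw₂ := d₂.hw
  have h' := h
  unfold SixSpec.image at h'
  rw [← hκ, ← hH, ← hxm, ← hj, ← hfwd] at ok₂ hw₂ h'
  exact eq_of_splice6_eq hE₁ hE₂ d₁.ok ok₂ d₁.hw hw₂ h'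

end Decode

/-! ### Counting: `q_N(ℍ) ≤ q_{N+6}(ℍ)` -/

section Count

open Classical in
/-- **The step-six map** on canonical rooted polygons (junk off `canonEnd n`, `n ≥ 5`). [cite: MadrasSlade1993, Theorem 3.2.3 (3.2.3) p. 64] -/
def stepSix (n : ℕ) (ω : ℕ → Site 2) : ℕ → Site 2 :=
  if h : Nonempty (SixSpec n ω) then h.some.image else ω

/-- **`#canonEnd n ≤ #canonEnd (n + 6)`** for `n ≥ 5`: the step-six map is an injection. [cite: MadrasSlade1993, Theorem 3.2.3 (3.2.3) p. 64 (ℤ^d: q_N ≤ q_{N+2}; honeycomb step 6 proved here)] -/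
theorem card_canonEnd_le_add_six (hn : 5 ≤ n) : #(canonEnd n) ≤ #(canonEnd (n + 6)) := by
  classical
  have hmaps : Set.MapsTo (stepSix n) ↑(canonEnd n) ↑(canonEnd (n + 6)) := by
    intro ω hω
    rw [Finset.mem_coe] at hω ⊢
    have hne := sixSpec_nonempty hω hn
    unfold stepSix; rw [dif_pos hne]
    exact splice6_mem_canonEnd hω hne.some.ok
  have hinj : Set.InjOn (stepSix n) ↑(canonEnd n) := by
    intro ω₁ hω₁ ω₂ hω₂ h
    rw [Finset.mem_coe] at hω₁ hω₂
    have hne₁ := sixSpec_nonempty hω₁ hn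
    have hne₂ := sixSpec_nonempty hω₂ hn
    unfold stepSix at h; rw [dif_pos hne₁, dif_pos hne₂] at h
    exact SixSpec.inj hω₁ hω₂ hne₁.some hne₂.some h
  exact Finset.card_le_card_of_injOn _ hmaps hinj

end Count

end PolygonConcat

open PolygonConcat

/-- **The honeycomb polygon numbers grow in steps of six: `q_N(ℍ) ≤ q_{N+6}(ℍ)` for every `N ≥ 6`** — the one even step that no join
of two polygons can produce (`q_4(ℍ) = q_8(ℍ) = 0`), by the five-case top-row surgery of this file (cases A, B above the rightmost top
brick; C1, C2, C0 when the top row is the single brick in column `0`).  With the tree's step `4` it gives `q_N(ℍ) ≤ q_{N+k}(ℍ)` for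
EVERY even `k ≥ 4` (`hexPolygonNumber_le_add_even_of_six_le` below); the step `2` fails at `N = 6, 10`.
[cite: MadrasSlade1993, Theorem 3.2.3 (3.2.3) p. 64 (ℤ^d: q_N ≤ q_{N+2})] [cite: Jensen2006HoneycombPolygons, §2 (the honeycomb polygon numbers)] -/
theorem hexPolygonNumber_le_add_six {N : ℕ} (hN : 6 ≤ N) : hexPolygonNumber N ≤ hexPolygonNumber (N + 6) := by
  obtain ⟨n, rfl⟩ : ∃ n, N = n + 1 := ⟨N - 1, by omega⟩
  rw [← card_canonEnd (by omega), show n + 1 + 6 = n + 6 + 1 by ring, ← card_canonEnd (by omega)]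
  exact card_canonEnd_le_add_six (by omega)

/-- **The honeycomb polygon numbers are monotone in every even step `k ≥ 4`: `q_N(ℍ) ≤ q_{N+k}(ℍ)` for `N ≥ 6`, `k` even,
`k ≥ 4`** — every such `k` is `4a` or `6 + 4a`, so the step `6` of this file and the tree's step `4` (`hexPolygonNumber_le_add_four`,
the join with a hexagon) suffice; in particular the step `10` needs no `12`-gon.  (The step `2` fails at `N = 6, 10`.)
[cite: MadrasSlade1993, Theorem 3.2.3 (3.2.3) p. 64 (ℤ^d: q_N ≤ q_{N+2})] [cite: Jensen2006HoneycombPolygons, §2 (the honeycomb polygon numbers)] -/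
theorem hexPolygonNumber_le_add_even_of_six_le {N k : ℕ} (hN : 6 ≤ N) (hk : Even k) (h4 : 4 ≤ k) :
    hexPolygonNumber N ≤ hexPolygonNumber (N + k) := by
  -- iterate the tree's step `4`
  have four : ∀ M j : ℕ, 3 ≤ M → hexPolygonNumber M ≤ hexPolygonNumber (M + 4 * j) := by
    intro M j hM
    induction j with
    | zero => simp
    | succ j ih =>
      refine ih.trans ?_
      have h := hexPolygonNumber_le_add_four (N := M + 4 * j) (by omega)
      rwa [show M + 4 * j + 4 = M + 4 * (j + 1) by ring] at h
  obtain ⟨a, rfl⟩ | ⟨a, rfl⟩ : (∃ a, k = 4 * a) ∨ (∃ a, k = 6 + 4 * a) := by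
    obtain ⟨m, rfl⟩ := hk
    rcases Nat.even_or_odd m with ⟨b, rfl⟩ | ⟨b, rfl⟩
    · exact Or.inl ⟨b, by omega⟩
    · exact Or.inr ⟨b - 1, by omega⟩
  · exact four N a (by omega)
  · calc hexPolygonNumber N ≤ hexPolygonNumber (N + 6) := hexPolygonNumber_le_add_six hN
      _ ≤ hexPolygonNumber (N + 6 + 4 * a) := four (N + 6) a (by omega)
      _ = hexPolygonNumber (N + (6 + 4 * a)) := by rw [add_assoc]

/-- **Monotonicity along the even lengths, difference form**: `q_N(ℍ) ≤ q_{N'}(ℍ)` whenever `6 ≤ N`, `N + 4 ≤ N'` and `N' − N` is even.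
[cite: MadrasSlade1993, Theorem 3.2.3 (3.2.3) p. 64 (ℤ^d: q_N ≤ q_{N+2})] [cite: Jensen2006HoneycombPolygons, §2 (the honeycomb polygon numbers)] -/
theorem hexPolygonNumber_mono_of_even_sub {N N' : ℕ} (hN : 6 ≤ N) (hNN' : N + 4 ≤ N') (he : Even (N' - N)) :
    hexPolygonNumber N ≤ hexPolygonNumber N' := by
  have h := hexPolygonNumber_le_add_even_of_six_le (k := N' - N) hN he (by omega)
  rwa [Nat.add_sub_cancel' (by omega)] at h


end HexBW

end Literature.Probability.RandomPlanarGeometry.SAW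

end
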